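import Literature.Probability.LatticeModels.SquareTilingConjugate
import HarnessLib

/-!
# Square tilings of lattice domains, IV: the flux across a crosscut

Topic: Probability / LatticeModels. Fourth file of the proof of [GP19] Corollary 4.15
(`SquareTilingModulus.lean`, `…Proofs.lean`, `…Limsup.lean`, `SquareTilingConjugate.lean`),
towards the lower half `lim inf_n R^eff_n ≥ d_Ω(T, B)`. In the planar dual of [GP19] §3 the
conjugate `h'` of the potential takes the values `0` and `I*` at the two outer vertices `l, r`;
on `ℤ²`, without abstract planar duality, the corresponding statement is the identity
`E(p_t, n_t) - E(p_b, n_b) = ± Σ_{x ∈ T_n} (current out of x)` between the virtual exit values of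
the conjugate (`SquareTiling.exitVal`) at the two ends of a crosscut of `Ω` from the open arc `1`
to the open arc `3`. It is proved here (`SquareTiling.exists_exits_flux_eq`) from:

* `Crossing`: straight runs of faces/squares and the count of vertical crossings (`vCrossSum`,
  `walkWinding_sub_walkWinding_rightRun`, `upRun`, `walkWinding_upRun_sub`);
* §W1 the flux of a closed walk of squares whose divergence is supported on two vertex sets on
  which the winding number is constant (`walkFlux_eq_mul_sum_div`, from the discrete divergence
  theorem `walkFlux_eq_sum_winding_mul_divAt` and `Σ div = 0`);
* §W2 constancy of the winding number of a closed walk along avoiding face walks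
  (`walkWinding_eq_of_walk_closed`), first exits (`Walk.exists_first_exit`), the flux along a
  walk of the component is the increment of the conjugate (`walkFlux_eq_dualPot_sub`);
* §W3 separation of squares touching distant sets, inner squares near compact subsets of `Ω`
  (`exists_forall_isInnerSq_of_near`);
* §W4 **the flux identity** for a loop `exit⁻¹ ++ (component walk) ++ exit ++ (flux-free closing)`
  (`exitVal_sub_exitVal_eq`);
* §W5 **the winding numbers on the two sides of a cross differ by one**
  (`walkWinding_sub_eq_one_of_cross`);
* §W6 exits along a walk, face walks along a boundary arc (`exists_faceWalk_along_arc`);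
* §W7 the main theorem `exists_exits_flux_eq`: given the cross data (two curves in `Ω` between
  opposite open arcs, straightened near their crossing point) and exterior closing curves, for
  small meshes the loop through the crosscut, the short boundary arcs at its ends
  (`exists_short_boundary_arc`) and the exterior has flux `±Σ_{T_n} div`, while its flux is the
  difference of the exit values.

Everything here is proved; no named fact is introduced.

## References

* [GeorgakopoulosPanagiotis2019] A. Georgakopoulos, C. Panagiotis, *Convergence of square tilings
  to the Riemann map*, arXiv:1910.06886 (2019), §3 (the planar dual, `h'(l) = 0`, `h'(r) = I*`).
* [Kesten1982] H. Kesten, *Percolation theory for mathematicians*, Birkhäuser 1982, §2.2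
  (winding numbers of lattice walks; the tree's `PlanarDuality.lean`).
-/

noncomputable section

namespace Literature.Probability.LatticeModels

open _root_.Filter _root_.Set _root_.Metric SimpleGraph
open scoped ENNReal NNReal _root_.Topology
open Literature.Probability.Percolation

namespace SquareTiling

section Crossing

variable {a b : Site 2}

/-- The signed number of traversals by the walk `p` of the vertical edge `{u + e₀, u + e₀ + e₁}`.
[folklore] -/
def vCrossSum (p : (zdGraph 2).Walk a b) (u : Site 2) : ℤ :=
  (p.darts.map fun d => vCross u d.fst d.snd).sum

/-- `vCrossSum` is additive under concatenation. [folklore] -/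
@[simp] theorem vCrossSum_append {c : Site 2} (p : (zdGraph 2).Walk a b) (q : (zdGraph 2).Walk b c) (u : Site 2) :
    vCrossSum (p.append q) u = vCrossSum p u + vCrossSum q u := by
  simp [vCrossSum, Walk.darts_append]

/-- `vCrossSum` of a walk with a first step. [folklore] -/
@[simp] theorem vCrossSum_cons {c : Site 2} (h : (zdGraph 2).Adj a b) (p : (zdGraph 2).Walk b c) (u : Site 2) :
    vCrossSum (Walk.cons h p) u = vCross u a b + vCrossSum p u := by
  simp [vCrossSum]

/-- `vCrossSum` of the trivial walk. [folklore] -/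
@[simp] theorem vCrossSum_nil (u : Site 2) : vCrossSum (Walk.nil : (zdGraph 2).Walk a a) u = 0 := rfl

/-- A walk not using the vertical edge `{u + e₀, u + e₀ + e₁}` has `vCrossSum = 0` there.
[folklore] -/
theorem vCrossSum_eq_zero_of_not_mem_edges {p : (zdGraph 2).Walk a b} {u : Site 2}
    (h : s(u + Pi.single 0 1, u + Pi.single 0 1 + Pi.single 1 1) ∉ p.edges) : vCrossSum p u = 0 := by
  refine List.sum_eq_zero fun t ht => ?_
  obtain ⟨d, hd, rfl⟩ := List.mem_map.1 ht
  refine vCross_eq_zero_of_ne fun heq => h ?_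
  rw [← heq]
  exact List.mem_map.2 ⟨d, hd, rfl⟩

/-- A walk none of whose vertices is `u + e₀` has `vCrossSum p u = 0`. [folklore] -/
theorem vCrossSum_eq_zero_of_not_mem_support {p : (zdGraph 2).Walk a b} {u : Site 2}
    (h : u + Pi.single 0 1 ∉ p.support) : vCrossSum p u = 0 :=
  vCrossSum_eq_zero_of_not_mem_edges fun he => h (Walk.fst_mem_support_of_mem_edges p he)

/-- **The winding difference along a rightward face run** of `k` steps from the face `u`: it is
the sum over the run of the signed traversals of the separating vertical edges. [folklore] -/
theorem walkWinding_sub_walkWinding_rightRun (p : (zdGraph 2).Walk a b) (u : Site 2) (k : ℕ) :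
    walkWinding p u - walkWinding p (u + (k : ℤ) • Pi.single 0 1) =
      ∑ j ∈ Finset.range k, vCrossSum p (u + (j : ℤ) • Pi.single 0 1) := by
  induction k with
  | zero => simp
  | succ k ih =>
    rw [Finset.sum_range_succ, ← ih]
    have h := walkWinding_sub_walkWinding_right p (u + (k : ℤ) • Pi.single 0 1)
    have e : u + (k : ℤ) • Pi.single 0 1 + Pi.single 0 1 = u + ((k + 1 : ℕ) : ℤ) • Pi.single 0 1 := by
      rw [add_assoc, Nat.cast_succ, add_smul, one_smul]
    rw [e] at h
    unfold vCrossSum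
    linarith

/-- The step up. [folklore] -/
theorem adj_add_single_one (z : Site 2) : (zdGraph 2).Adj z (z + Pi.single 1 1) :=
  adj_of_stepKind (.up (by simp) (by simp))

/-- The straight walk of `k` steps up from `z`. [folklore] -/
def upRun (z : Site 2) : (k : ℕ) → (zdGraph 2).Walk z (z + (k : ℤ) • Pi.single 1 1)
  | 0 => (Walk.nil : (zdGraph 2).Walk z z).copy rfl (by simp)
  | k + 1 => (Walk.cons (adj_add_single_one z) (upRun (z + Pi.single 1 1) k)).copy rfl
      (by rw [add_assoc, Nat.cast_succ, add_smul, one_smul, add_comm ((k : ℤ) • _)])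

/-- The vertices of an upward run. [folklore] -/
theorem mem_support_upRun {z w : Site 2} {k : ℕ} :
    w ∈ (upRun z k).support ↔ w 0 = z 0 ∧ z 1 ≤ w 1 ∧ w 1 ≤ z 1 + k := by
  induction k generalizing z with
  | zero =>
    simp only [upRun, Walk.support_copy, Walk.support_nil, List.mem_singleton, Nat.cast_zero, add_zero]
    rw [Site.eq_iff_two]; omega
  | succ k ih =>
    simp only [upRun, Walk.support_copy, Walk.support_cons, List.mem_cons, ih, Pi.add_apply, Nat.cast_succ]
    rw [Site.eq_iff_two]
    simp
    omega

/-- **Traversals of a vertical edge by an upward run**: the run from `z` of `k` steps traverses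
the edge `{u + e₀, u + e₀ + e₁}` (once, upwards) iff that edge lies on the run. [folklore] -/
theorem vCrossSum_upRun (z : Site 2) (k : ℕ) (u : Site 2) :
    vCrossSum (upRun z k) u = if u 0 + 1 = z 0 ∧ z 1 ≤ u 1 ∧ u 1 + 1 ≤ z 1 + k then 1 else 0 := by
  induction k generalizing z with
  | zero =>
    simp only [upRun, vCrossSum, Walk.darts_copy, Walk.darts_nil, List.map_nil, List.sum_nil, Nat.cast_zero, add_zero]
    split_ifs with h
    · omega
    · rfl
  | succ k ih =>
    have : vCrossSum (upRun z (k + 1)) u = vCross u z (z + Pi.single 1 1) + vCrossSum (upRun (z + Pi.single 1 1) k) u := by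
      simp only [upRun, vCrossSum, Walk.darts_copy, Walk.darts_cons, List.map_cons, List.sum_cons]
    rw [this, ih]
    unfold vCross
    simp only [Pi.add_apply, Nat.cast_succ]
    simp
    split_ifs <;> omega

/-- **The crossing number of an upward run with a rightward face run.** If the face run from
`u` of `m` steps passes the column of the upward run (from `z`, `k` steps) at a level met by the
run, the winding numbers of the run at the two ends of the face run differ by exactly one.
[folklore] -/
theorem walkWinding_upRun_sub (z u : Site 2) (k m : ℕ) (hcol : u 0 + 1 ≤ z 0) (hcol' : z 0 ≤ u 0 + m)
    (hrow : z 1 ≤ u 1) (hrow' : u 1 + 1 ≤ z 1 + k) :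
    walkWinding (upRun z k) u - walkWinding (upRun z k) (u + (m : ℤ) • Pi.single 0 1) = 1 := by
  rw [walkWinding_sub_walkWinding_rightRun]
  simp only [vCrossSum_upRun, Pi.add_apply, Pi.smul_apply, smul_eq_mul]
  simp
  -- exactly one `j < m` has `u 0 + j + 1 = z 0`
  have : (Finset.range m).filter (fun j : ℕ => u 0 + j + 1 = z 0 ∧ z 1 ≤ u 1 ∧ u 1 < z 1 + k) = {(z 0 - u 0 - 1).toNat} := by
    ext j
    simp only [Finset.mem_filter, Finset.mem_range, Finset.mem_singleton]
    omega
  rw [this, Finset.card_singleton]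

end Crossing


/-! ### §W0. Step fluxes in the four directions -/

section StepDirections

variable {Ω : Set ℂ} {δ : ℝ}

/-- Step flux of a right step. [folklore] -/
theorem stepFlux_right_eq (jh jv : Site 2 → ℝ) (x : Site 2) :
    stepFlux jh jv x (x + Pi.single 0 1) = -jv (x - Pi.single 1 1) := by
  unfold stepFlux
  have c0 : (x + Pi.single 0 1 : Site 2) 0 = x 0 + 1 := by simp
  have c1 : (x + Pi.single 0 1 : Site 2) 1 = x 1 := by simp
  simp [c0, c1]

/-- Step flux of an up step. [folklore] -/
theorem stepFlux_up_eq (jh jv : Site 2 → ℝ) (x : Site 2) :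
    stepFlux jh jv x (x + Pi.single 1 1) = jh (x - Pi.single 0 1) := by
  unfold stepFlux
  have c0 : (x + Pi.single 1 1 : Site 2) 0 = x 0 := by simp
  have c1 : (x + Pi.single 1 1 : Site 2) 1 = x 1 + 1 := by simp
  simp [c0, c1]

/-- The CR-increment of `h'` across the right side of the square `x`. [folklore] -/
theorem stepFlux_right_cur (h : Site 2 → ℝ) (x : Site 2) :
    stepFlux (curH Ω δ h) (curV Ω δ h) x (x + Pi.single 0 1) = -cur Ω δ h (x + Pi.single 0 1) (x + Pi.single 0 1 + Pi.single 1 1) := by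
  rw [stepFlux_right_eq, curV]
  congr 2 <;> rw [one_eq_single_add_single] <;> abel

/-- Across the top side. [folklore] -/
theorem stepFlux_up_cur (h : Site 2 → ℝ) (x : Site 2) :
    stepFlux (curH Ω δ h) (curV Ω δ h) x (x + Pi.single 1 1) = cur Ω δ h (x + Pi.single 1 1) (x + Pi.single 1 1 + Pi.single 0 1) := by
  rw [stepFlux_up_eq, curH]
  congr 1 <;> rw [one_eq_single_add_single] <;> abel

end StepDirections

/-! ### §W1. Algebra of the flux/winding identity -/

section FluxAlgebra

variable {a b : Site 2}

/-- Rotating a closed walk does not change its flux. [folklore] -/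
theorem walkFlux_rotate [DecidableEq (Site 2)] (jh jv : Site 2 → ℝ) {u : Site 2} (c : (zdGraph 2).Walk a a) (hu : u ∈ c.support) :
    walkFlux jh jv (c.rotate u hu) = walkFlux jh jv c := by
  have h1 : ∀ {x y : Site 2} (w : (zdGraph 2).Walk x y), walkFlux jh jv w = (w.darts.map fun d => stepFlux jh jv d.fst d.snd).sum := by
    intro x y w
    induction w with
    | nil => rfl
    | cons h p ih => rw [walkFlux_cons, ih]; simp
  rw [h1, h1]
  exact ((Walk.rotate_darts c u hu).perm.map _).sum_eq

/-- Rotating a closed walk does not change its winding numbers. [folklore] -/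
theorem walkWinding_rotate [DecidableEq (Site 2)] {u : Site 2} (c : (zdGraph 2).Walk a a) (hu : u ∈ c.support) (z : Site 2) :
    walkWinding (c.rotate u hu) z = walkWinding c z := by
  unfold walkWinding
  exact ((Walk.rotate_darts c u hu).perm.map _).sum_eq

/-- The total divergence over a set carrying the currents vanishes. [folklore] -/
theorem sum_divAt_eq_zero {jh jv : Site 2 → ℝ} {S : Finset (Site 2)}
    (hS : ∀ u ∉ S, jh u = 0 ∧ jv u = 0)
    (hS' : ∀ u ∉ S, jh (u - Pi.single 0 1) = 0 ∧ jv (u - Pi.single 1 1) = 0) :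
    ∑ u ∈ S, divAt jh jv u = 0 := by
  classical
  have shift : ∀ (e : Site 2) (g : Site 2 → ℝ), (∀ u ∉ S, g u = 0) → (∀ u ∉ S, g (u - e) = 0) →
      ∑ u ∈ S, g (u - e) = ∑ u ∈ S, g u := by
    intro e g hg hg'
    -- both sides equal the sum over `S ∪ (S.image (· - e))`
    have h1 : ∑ u ∈ S, g (u - e) = ∑ v ∈ S.image (· - e), g v := by
      rw [Finset.sum_image fun x _ y _ h => sub_left_inj.1 h]
    rw [h1]
    refine (Finset.sum_subset_zero_on_sdiff (Finset.subset_union_right) ?_ fun _ _ => rfl).trans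
      ((Finset.sum_subset_zero_on_sdiff (Finset.subset_union_left) ?_ fun _ _ => rfl).symm)
    · intro v hv
      rw [Finset.mem_sdiff] at hv
      by_cases hvS : v ∈ S
      · have : v + e ∉ S := by
          intro h'
          exact hv.2 (Finset.mem_image.2 ⟨v + e, h', by simp⟩)
        simpa using hg' (v + e) this
      · exact hg v hvS
    · intro v hv
      rw [Finset.mem_sdiff] at hv
      exact hg v hv.2
  unfold divAt
  rw [Finset.sum_sub_distrib, Finset.sum_sub_distrib, Finset.sum_add_distrib,
    shift (Pi.single 0 1) jh (fun u hu => (hS u hu).1) (fun u hu => (hS' u hu).1),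
    shift (Pi.single 1 1) jv (fun u hu => (hS u hu).2) (fun u hu => (hS' u hu).2)]
  ring

/-- **Flux of a closed walk with windings constant on the sources and on the sinks.** If the
divergence vanishes off `ST ∪ SB ⊆ S`, the winding number of `Λ` is `kT` on `ST` and `kB` on
`SB`, then `flux(Λ) = (kT - kB) · Σ_{ST} div`. [folklore] -/
theorem walkFlux_eq_mul_sum_div {jh jv : Site 2 → ℝ} {S ST SB : Finset (Site 2)}
    (hS : ∀ u ∉ S, jh u = 0 ∧ jv u = 0)
    (hS' : ∀ u ∉ S, jh (u - Pi.single 0 1) = 0 ∧ jv (u - Pi.single 1 1) = 0)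
    (hTS : ST ⊆ S) (hBS : SB ⊆ S) (hTB : Disjoint ST SB)
    (hdiv : ∀ u ∈ S, u ∉ ST → u ∉ SB → divAt jh jv u = 0)
    (Λ : (zdGraph 2).Walk a a) {kT kB : ℤ} (hT : ∀ u ∈ ST, walkWinding Λ u = kT) (hB : ∀ u ∈ SB, walkWinding Λ u = kB) :
    walkFlux jh jv Λ = ((kT - kB : ℤ) : ℝ) * ∑ u ∈ ST, divAt jh jv u := by
  classical
  rw [walkFlux_eq_sum_winding_mul_divAt hS hS' Λ]
  have htot := sum_divAt_eq_zero hS hS'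
  -- split `S = ST ∪ SB ∪ rest`
  have hsplit : ∀ g : Site 2 → ℝ, (∀ u ∈ S, u ∉ ST → u ∉ SB → g u = 0) →
      ∑ u ∈ S, g u = ∑ u ∈ ST, g u + ∑ u ∈ SB, g u := by
    intro g hg
    rw [← Finset.sum_union hTB]
    symm
    refine Finset.sum_subset (Finset.union_subset hTS hBS) fun u hu hu' => ?_
    rw [Finset.mem_union, not_or] at hu'
    exact hg u hu hu'.1 hu'.2
  rw [hsplit _ (fun u hu h1 h2 => by rw [hdiv u hu h1 h2, mul_zero])]
  rw [hsplit _ (fun u hu h1 h2 => hdiv u hu h1 h2)] at htot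
  have e1 : ∑ u ∈ ST, (walkWinding Λ u : ℝ) * divAt jh jv u = (kT : ℝ) * ∑ u ∈ ST, divAt jh jv u := by
    rw [Finset.mul_sum]; exact Finset.sum_congr rfl fun u hu => by rw [hT u hu]
  have e2 : ∑ u ∈ SB, (walkWinding Λ u : ℝ) * divAt jh jv u = (kB : ℝ) * ∑ u ∈ SB, divAt jh jv u := by
    rw [Finset.mul_sum]; exact Finset.sum_congr rfl fun u hu => by rw [hB u hu]
  rw [e1, e2]
  have : ∑ u ∈ SB, divAt jh jv u = -∑ u ∈ ST, divAt jh jv u := by linarith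
  rw [this]; push_cast; ring

end FluxAlgebra

/-! ### §W2. Combinatorial tools: constancy of winding for closed walks, first exits, fluxes of
component walks, flux-free darts -/

section CombTools

variable {δ : ℝ}

/-- For a CLOSED lattice walk, the winding numbers at `u` and `u + e₁` agree when the walk does
not use the horizontal edge between the faces (no boundary term). [folklore] -/
theorem walkWinding_eq_walkWinding_up_closed {a : Site 2} {p : (zdGraph 2).Walk a a} {u : Site 2}
    (h : s(u + Pi.single 1 1, u + Pi.single 1 1 + Pi.single 0 1) ∉ p.edges) :
    walkWinding p u = walkWinding p (u + Pi.single 1 1) := by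
  have hsum : (p.darts.map fun d => hCross u d.fst d.snd).sum = 0 := by
    refine List.sum_eq_zero fun t ht => ?_
    obtain ⟨d, hd, rfl⟩ := List.mem_map.1 ht
    refine hCross_eq_zero_of_ne fun heq => h ?_
    rw [← heq]
    exact List.mem_map.2 ⟨d, hd, rfl⟩
  have := walkWinding_sub_walkWinding_up p u
  rw [hsum, sub_self] at this
  linarith

/-- **Constancy of the winding number of a closed walk along an avoiding walk of faces.**
[folklore] -/
theorem walkWinding_eq_of_walk_closed {a : Site 2} (p : (zdGraph 2).Walk a a) {c d : Site 2} (q : (zdGraph 2).Walk c d)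
    (hq : ∀ z ∈ q.support, z ∉ p.support) : walkWinding p c = walkWinding p d := by
  induction q with
  | nil => rfl
  | cons h q ih =>
    rename_i x y z
    have hx : x ∉ p.support := hq x (by simp)
    have hy : y ∉ p.support := hq y (by simp)
    have notEdge : ∀ {v w : Site 2}, v ∉ p.support → s(v, w) ∉ p.edges :=
      fun hv he => hv (Walk.fst_mem_support_of_mem_edges p he)
    have hstep : walkWinding p x = walkWinding p y := by
      rcases stepKind_of_adj h with ⟨h0, h1⟩ | ⟨h0, h1⟩ | ⟨h1, h0⟩ | ⟨h1, h0⟩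
      · have e : y = x + Pi.single 0 1 := by simp [Site.eq_iff_two, h0, h1]
        rw [e]; exact walkWinding_eq_walkWinding_right (notEdge (by rw [← e]; exact hy))
      · have e : x = y + Pi.single 0 1 := by simp [Site.eq_iff_two, h0, h1]
        rw [e]; exact (walkWinding_eq_walkWinding_right (notEdge (by rw [← e]; exact hx))).symm
      · have e : y = x + Pi.single 1 1 := by simp [Site.eq_iff_two, h0, h1]
        rw [e]; exact walkWinding_eq_walkWinding_up_closed (notEdge (by rw [← e]; exact hy))
      · have e : x = y + Pi.single 1 1 := by simp [Site.eq_iff_two, h0, h1]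
        rw [e]; exact (walkWinding_eq_walkWinding_up_closed (notEdge (by rw [← e]; exact hx))).symm
    rw [hstep]
    exact ih fun w hw => hq w (by simp [hw])

/-- **First exit of a walk from a set.** A walk from a vertex in `F` to a vertex outside `F`
splits at its first dart leaving `F`. [folklore] -/
theorem Walk.exists_first_exit {V : Type*} {G : SimpleGraph V} {F : Set V} :
    ∀ {c s : V} (w : G.Walk c s), c ∈ F → s ∉ F →
      ∃ (p n : V) (h : G.Adj p n) (w₁ : G.Walk c p) (w₂ : G.Walk n s),
        w = w₁.append (Walk.cons h w₂) ∧ (∀ z ∈ w₁.support, z ∈ F) ∧ n ∉ F := by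
  intro c s w
  induction w with
  | nil => intro hc hs; exact (hs hc).elim
  | cons h w ih =>
    rename_i x y z
    intro hx hz
    by_cases hy : y ∈ F
    · obtain ⟨p, n, h', w₁, w₂, hw, hF, hn⟩ := ih hy hz
      exact ⟨p, n, h', Walk.cons h w₁, w₂, by rw [hw]; rfl, fun v hv => by
        rw [Walk.support_cons, List.mem_cons] at hv
        rcases hv with rfl | hv
        · exact hx
        · exact hF v hv, hn⟩
    · exact ⟨x, y, h, Walk.nil, w, rfl, fun v hv => by simp at hv; rw [hv]; exact hx, hy⟩

/-- A `zdGraph` walk all of whose vertices are inner squares lifts to the dual graph. [folklore] -/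
theorem exists_dualGraph_walk {Ω : Set ℂ} :
    ∀ {x y : Site 2} (w : (zdGraph 2).Walk x y), (∀ z ∈ w.support, IsInnerSq Ω δ z) →
      ∃ W : (dualGraph Ω δ).Walk x y, W.map (Hom.ofLE dualGraph_le_zdGraph) = w := by
  intro x y w
  induction w with
  | nil => intro _; exact ⟨Walk.nil, rfl⟩
  | cons h w ih =>
    rename_i a b c
    intro hs
    have ha : IsInnerSq Ω δ a := hs a (by simp)
    have hb : IsInnerSq Ω δ b := hs b (by simp)
    obtain ⟨W, hW⟩ := ih fun z hz => hs z (by simp [hz])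
    refine ⟨Walk.cons (dualGraph_adj_iff.2 ⟨h, ha, hb⟩) W, ?_⟩
    simp [hW]

open Classical in
/-- **Flux along a walk of the component is the increment of the conjugate.** [folklore] -/
theorem walkFlux_eq_dualPot_sub (R : RandomPlanarGeometry.ConformalRectangle) (h0 : (0 : ℂ) ∈ R.carrier)
    (hδ : 0 < δ) {h : Site 2 → ℝ} {T B : Set (Site 2)} (hT : T ⊆ boundary R.carrier δ) (hB : B ⊆ boundary R.carrier δ)
    (hharm : ∀ x, x ∉ T → x ∉ B →
      ∑ y ∈ ((zdGraph 2).neighborFinset x).filter (fun y => (domainGraph R.carrier δ).Adj x y), (h y - h x) = 0)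
    {p₀ x y : Site 2} (hp₀ : IsInnerSq R.carrier δ p₀) (hx : (dualGraph R.carrier δ).Reachable p₀ x)
    (w : (zdGraph 2).Walk x y) (hw : ∀ z ∈ w.support, IsInnerSq R.carrier δ z) :
    walkFlux (curH R.carrier δ h) (curV R.carrier δ h) w =
      dualPot R.carrier δ h p₀ y - dualPot R.carrier δ h p₀ x := by
  obtain ⟨W, hW⟩ := exists_dualGraph_walk w hw
  obtain ⟨W₀⟩ := hx
  have e : walkFlux (curH R.carrier δ h) (curV R.carrier δ h) (W.map (Hom.ofLE dualGraph_le_zdGraph)) =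
      walkFlux (curH R.carrier δ h) (curV R.carrier δ h) w := congrArg _ hW
  rw [dualPot_eq_walkFlux R h0 hδ hT hB hharm hp₀ (W₀.append W), dualPot_eq_walkFlux R h0 hδ hT hB hharm hp₀ W₀,
    Walk.map_append, walkFlux_append, e]
  ring

/-- The edge of a right step / up step in terms of `sepLo`, `sepHi`. [folklore] -/
theorem sepLo_sepHi_right (x : Site 2) :
    sepLo x (x + Pi.single 0 1) = x + Pi.single 0 1 ∧ sepHi x (x + Pi.single 0 1) = x + Pi.single 0 1 + Pi.single 1 1 := by
  constructor
  · rw [sepLo]; ext i; fin_cases i <;> simp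
  · rw [sepHi, if_neg (show ¬ (x 0 = (x + Pi.single 0 1 : Site 2) 0) by simp)]
    ext i; fin_cases i <;> simp

/-- The edge of an up step. [folklore] -/
theorem sepLo_sepHi_up (x : Site 2) :
    sepLo x (x + Pi.single 1 1) = x + Pi.single 1 1 ∧ sepHi x (x + Pi.single 1 1) = x + Pi.single 1 1 + Pi.single 0 1 := by
  constructor
  · rw [sepLo]; ext i; fin_cases i <;> simp
  · rw [sepHi, if_pos (show (x 0 = (x + Pi.single 1 1 : Site 2) 0) by simp)]
    ext i; fin_cases i <;> simp

/-- A dart whose crossed side has an endpoint outside the vertex set `domain` carries no flux.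
[folklore] -/
theorem stepFlux_eq_zero_of_not_mem_domain {Ω : Set ℂ} (h : Site 2 → ℝ) {x y : Site 2} (hxy : (zdGraph 2).Adj x y)
    (hc : sepLo x y ∉ domain Ω δ ∨ sepHi x y ∉ domain Ω δ) :
    stepFlux (curH Ω δ h) (curV Ω δ h) x y = 0 := by
  have key : ∀ a b : Site 2, (a ∉ domain Ω δ ∨ b ∉ domain Ω δ) → cur Ω δ h a b = 0 := by
    intro a b hab
    apply cur_of_not_adj
    intro hadj
    rcases hab with ha | hb
    · exact ha (domainGraph_adj_iff.1 hadj).2.1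
    · exact hb (domainGraph_adj_iff.1 hadj).2.2
  -- the two positive directions
  have hright : ∀ x : Site 2, (sepLo x (x + Pi.single 0 1) ∉ domain Ω δ ∨ sepHi x (x + Pi.single 0 1) ∉ domain Ω δ) →
      stepFlux (curH Ω δ h) (curV Ω δ h) x (x + Pi.single 0 1) = 0 := by
    intro x hc
    rw [(sepLo_sepHi_right x).1, (sepLo_sepHi_right x).2] at hc
    rw [stepFlux_right_cur, key _ _ hc, neg_zero]
  have hup : ∀ x : Site 2, (sepLo x (x + Pi.single 1 1) ∉ domain Ω δ ∨ sepHi x (x + Pi.single 1 1) ∉ domain Ω δ) →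
      stepFlux (curH Ω δ h) (curV Ω δ h) x (x + Pi.single 1 1) = 0 := by
    intro x hc
    rw [(sepLo_sepHi_up x).1, (sepLo_sepHi_up x).2] at hc
    rw [stepFlux_up_cur, key _ _ hc]
  rcases stepKind_of_adj hxy with ⟨h0', h1'⟩ | ⟨h0', h1'⟩ | ⟨h1', h0'⟩ | ⟨h1', h0'⟩
  · have hy : y = x + Pi.single 0 1 := by simp [Site.eq_iff_two, h0', h1']
    subst hy; exact hright x hc
  · have hx : x = y + Pi.single 0 1 := by simp [Site.eq_iff_two, h0', h1']
    subst hx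
    rw [stepFlux_antisymm _ _ (.right (by simp) (by simp)), hright y (by rwa [sepLo_comm, sepHi_comm]), neg_zero]
  · have hy : y = x + Pi.single 1 1 := by simp [Site.eq_iff_two, h0', h1']
    subst hy; exact hup x hc
  · have hx : x = y + Pi.single 1 1 := by simp [Site.eq_iff_two, h0', h1']
    subst hx
    rw [stepFlux_antisymm _ _ (.up (by simp) (by simp)), hup y (by rwa [sepLo_comm, sepHi_comm]), neg_zero]

end CombTools

/-! ### §W3. Squares near sets; the bulk; the straight column -/

section NearSets

open WeakBeurling

variable {Ω : Set ℂ} {δ : ℝ}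

/-- **Separation.** A square cannot touch two sets more than `2δ` apart. [folklore] -/
theorem not_near_both {X Y : Set ℂ} {q : Site 2} (hX : ∃ x ∈ X, x ∈ closedSq δ q) (hY : ∃ y ∈ Y, y ∈ closedSq δ q)
    (hsep : ∀ x ∈ X, ∀ y ∈ Y, 2 * δ < dist x y) : False := by
  obtain ⟨x, hx, hxq⟩ := hX
  obtain ⟨y, hy, hyq⟩ := hY
  exact lt_irrefl _ ((hsep x hx y hy).trans_le (dist_le_of_mem_closedSq hxq hyq))

/-- Squares touching a set `X` differ from squares touching a set `Y` more than `2δ` away.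
[folklore] -/
theorem ne_of_near {X Y : Set ℂ} {q q' : Site 2} (hX : ∃ x ∈ X, x ∈ closedSq δ q) (hY : ∃ y ∈ Y, y ∈ closedSq δ q')
    (hsep : ∀ x ∈ X, ∀ y ∈ Y, 2 * δ < dist x y) : q ≠ q' := by
  rintro rfl; exact not_near_both hX hY hsep

/-- Compact and closed disjoint sets are uniformly apart. [folklore] -/
theorem exists_pos_forall_lt_dist {X Y : Set ℂ} (hX : IsCompact X) (hY : IsClosed Y) (hXY : Disjoint X Y) :
    ∃ η > 0, ∀ x ∈ X, ∀ y ∈ Y, η < dist x y := by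
  obtain ⟨η, hη, hdisj⟩ := hXY.exists_cthickenings hX hY
  refine ⟨η, hη, fun x hx y hy => ?_⟩
  by_contra hle
  push Not at hle
  have h1 : y ∈ Metric.cthickening η X :=
    Metric.mem_cthickening_of_dist_le y x η X hx (by rwa [_root_.dist_comm])
  have h2 : y ∈ Metric.cthickening η Y := Metric.self_subset_cthickening Y hy
  exact Set.disjoint_left.1 hdisj h1 h2

/-- **Shadows stay near their path**: every square of a shadow of `γ|[a,b]` touches the image
`γ([a,b])`. (Restatement of the support property of `exists_dualWalk_of_path`.) [folklore] -/
theorem near_of_shadow {γ : ℝ → ℂ} {a b : ℝ} {P P' : Site 2} {ω : (zdGraph 2).Walk P P'}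
    (hω : ∀ q ∈ ω.support, ∃ t ∈ Icc a b, γ t ∈ closedSq δ q) {q : Site 2} (hq : q ∈ ω.support) :
    ∃ x ∈ γ '' Icc a b, x ∈ closedSq δ q := by
  obtain ⟨t, ht, hγ⟩ := hω q hq
  exact ⟨γ t, mem_image_of_mem γ ht, hγ⟩

/-- **Inner squares in the bulk.** If `B̄(z, r) ⊆ Ω`, then for all small meshes every square
whose lower-left mesh point lies in `B(z, r/2)` is inner. [folklore] -/
theorem exists_forall_isInnerSq (hΩo : IsOpen Ω) (hΩc : IsConnected Ω) (hne : Ωᶜ.Nonempty)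
    (h0 : (0 : ℂ) ∈ Ω) {z : ℂ} {r : ℝ} (hr : 0 < r) (hzr : closedBall z r ⊆ Ω) :
    ∃ δ₀ > 0, ∀ δ, 0 < δ → δ < δ₀ → ∀ x : Site 2, meshPoint δ x ∈ ball z (r / 2) → IsInnerSq Ω δ x := by
  obtain ⟨δ₁, hδ₁, hdom⟩ := exists_forall_mem_domain hΩo hΩc hne h0 (isCompact_closedBall z r) hzr
  refine ⟨min δ₁ (r / 8), by positivity, fun δ hδ hδlt x hx => ?_⟩
  have hδ₁' : δ < δ₁ := hδlt.trans_le (min_le_left _ _)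
  have hδr : δ < r / 8 := hδlt.trans_le (min_le_right _ _)
  have hsq : closedSq δ x ⊆ closedBall z r := by
    intro w hw
    have h1 := dist_le_of_mem_closedSq hw (meshPoint_mem_closedSq hδ.le (Or.inl rfl) (Or.inl rfl) : meshPoint δ x ∈ closedSq δ x)
    rw [Metric.mem_closedBall]
    rw [Metric.mem_ball] at hx
    linarith [dist_triangle w (meshPoint δ x) z]
  have hsqΩ : closedSq δ x ⊆ Ω := hsq.trans hzr
  refine isInnerSq_of_sides_subset ?_ ?_ ?_ ?_ (Or.inl (hdom δ hδ hδ₁' x (hsq (meshPoint_mem_closedSq hδ.le (Or.inl rfl) (Or.inl rfl)))))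
  · exact (side_subset_closedSq hδ.le ⟨Or.inl rfl, Or.inl rfl⟩ ⟨Or.inr (by simp), Or.inl (by simp)⟩).trans hsqΩ
  · exact (side_subset_closedSq hδ.le ⟨Or.inl (by simp), Or.inr (by simp)⟩ ⟨Or.inr (by simp), Or.inr (by simp)⟩).trans hsqΩ
  · exact (side_subset_closedSq hδ.le ⟨Or.inl rfl, Or.inl rfl⟩ ⟨Or.inl (by simp), Or.inr (by simp)⟩).trans hsqΩ
  · exact (side_subset_closedSq hδ.le ⟨Or.inr (by simp), Or.inl (by simp)⟩ ⟨Or.inr (by simp), Or.inr (by simp)⟩).trans hsqΩ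

/-- **Squares touching a compact set inside `Ω` are inner for small meshes**: if `K ⊆ Ω` is
compact, for all small `δ` every square touching `K` is inner. [folklore] -/
theorem exists_forall_isInnerSq_of_near (hΩo : IsOpen Ω) (hΩc : IsConnected Ω) (hne : Ωᶜ.Nonempty)
    (h0 : (0 : ℂ) ∈ Ω) {K : Set ℂ} (hK : IsCompact K) (hKΩ : K ⊆ Ω) :
    ∃ δ₀ > 0, ∀ δ, 0 < δ → δ < δ₀ → ∀ x : Site 2, (∃ w ∈ K, w ∈ closedSq δ x) → IsInnerSq Ω δ x := by
  -- thicken `K` inside `Ω`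
  obtain ⟨ρ, hρ, hthick⟩ := hK.exists_thickening_subset_open hΩo hKΩ
  set K' : Set ℂ := Metric.cthickening (ρ / 2) K with hK'
  have hK'c : IsCompact K' := hK.cthickening
  have hK'Ω : K' ⊆ Ω := (Metric.cthickening_subset_thickening' hρ (by linarith) K).trans hthick
  obtain ⟨δ₁, hδ₁, hdom⟩ := exists_forall_mem_domain hΩo hΩc hne h0 hK'c hK'Ω
  refine ⟨min δ₁ (ρ / 8), by positivity, fun δ hδ hδlt x hx => ?_⟩
  have hδ₁' : δ < δ₁ := hδlt.trans_le (min_le_left _ _)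
  have hδr : δ < ρ / 8 := hδlt.trans_le (min_le_right _ _)
  obtain ⟨w, hwK, hwx⟩ := hx
  have hsq : closedSq δ x ⊆ K' := by
    intro v hv
    have h1 := dist_le_of_mem_closedSq hv hwx
    rw [hK']
    exact Metric.mem_cthickening_of_dist_le v w (ρ / 2) K hwK (by linarith)
  have hsqΩ : closedSq δ x ⊆ Ω := hsq.trans hK'Ω
  refine isInnerSq_of_sides_subset ?_ ?_ ?_ ?_ (Or.inl (hdom δ hδ hδ₁' x (hsq (meshPoint_mem_closedSq hδ.le (Or.inl rfl) (Or.inl rfl)))))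
  · exact (side_subset_closedSq hδ.le ⟨Or.inl rfl, Or.inl rfl⟩ ⟨Or.inr (by simp), Or.inl (by simp)⟩).trans hsqΩ
  · exact (side_subset_closedSq hδ.le ⟨Or.inl (by simp), Or.inr (by simp)⟩ ⟨Or.inr (by simp), Or.inr (by simp)⟩).trans hsqΩ
  · exact (side_subset_closedSq hδ.le ⟨Or.inl rfl, Or.inl rfl⟩ ⟨Or.inl (by simp), Or.inr (by simp)⟩).trans hsqΩ
  · exact (side_subset_closedSq hδ.le ⟨Or.inr (by simp), Or.inl (by simp)⟩ ⟨Or.inr (by simp), Or.inr (by simp)⟩).trans hsqΩ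

/-- **A walk of inner squares through the base lies in the component.** [folklore] -/
theorem reachable_of_mem_support_inner {p₀ x y : Site 2} (w : (zdGraph 2).Walk x y)
    (hw : ∀ z ∈ w.support, IsInnerSq Ω δ z) (hp₀ : p₀ ∈ w.support) {q : Site 2} (hq : q ∈ w.support) :
    (dualGraph Ω δ).Reachable p₀ q := by
  classical
  obtain ⟨W₁, -⟩ := exists_dualGraph_walk (w.takeUntil p₀ hp₀) fun z hz => hw z (Walk.support_takeUntil_subset_support w hp₀ hz)
  obtain ⟨W₂, -⟩ := exists_dualGraph_walk (w.takeUntil q hq) fun z hz => hw z (Walk.support_takeUntil_subset_support w hq hz)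
  exact ⟨W₁.reverse.append W₂⟩

/-- The point at height `(y + 1/2) δ` on the vertical line `re = xs` lies in the closed square
`(⌊xs/δ⌋, y)`. [folklore] -/
theorem mem_closedSq_col (hδ : 0 < δ) (xs : ℝ) (y : ℤ) :
    (⟨xs, ((y : ℝ) + 1 / 2) * δ⟩ : ℂ) ∈ closedSq δ ![⌊xs / δ⌋, y] := by
  have h1 := Int.floor_le (xs / δ)
  rw [le_div_iff₀ hδ] at h1
  have h2 := (Int.lt_floor_add_one (xs / δ)).le
  rw [div_le_iff₀ hδ] at h2
  refine ⟨?_, ?_, ?_, ?_⟩ <;> simp <;> nlinarith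

/-- The point at abscissa `(x + 1/2) δ` on the horizontal line `im = ys` lies in the closed square
`(x, ⌊ys/δ⌋)`. [folklore] -/
theorem mem_closedSq_row (hδ : 0 < δ) (ys : ℝ) (x : ℤ) :
    (⟨((x : ℝ) + 1 / 2) * δ, ys⟩ : ℂ) ∈ closedSq δ ![x, ⌊ys / δ⌋] := by
  have h1 := Int.floor_le (ys / δ)
  rw [le_div_iff₀ hδ] at h1
  have h2 := (Int.lt_floor_add_one (ys / δ)).le
  rw [div_le_iff₀ hδ] at h2
  refine ⟨?_, ?_, ?_, ?_⟩ <;> simp <;> nlinarith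

end NearSets

/-! ### §W4. The flux identity for a crosscut closed through the exterior -/

section FluxIdentity

open WeakBeurling

variable {δ : ℝ}

/-- Vertices of `Ω_n` lie in the box `⌈r₀/δ⌉`. [folklore] -/
theorem mem_sqBox_of_mem_domain {Ω : Set ℂ} (h0 : (0 : ℂ) ∈ Ω) {r₀ : ℝ} (hΩ : Ω ⊆ closedBall 0 r₀) (hδ : 0 < δ)
    {x : Site 2} (hxd : x ∈ domain Ω δ) : x ∈ sqBox 0 ⌈r₀ / δ⌉ := by
  have hxΩ : meshPoint δ x ∈ Ω := mem_meshVertices_iff.1 (domain_subset_meshVertices h0 hxd)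
  have hn : ‖meshPoint δ x‖ ≤ r₀ := by simpa using hΩ hxΩ
  have hc : r₀ / δ ≤ ⌈r₀ / δ⌉ := Int.le_ceil _
  rw [div_le_iff₀ hδ] at hc
  have kk : ∀ i : Fin 2, |(x i : ℝ)| * δ ≤ r₀ := by
    intro i
    have h1 : |δ * (x i : ℝ)| ≤ ‖meshPoint δ x‖ := by
      fin_cases i
      · simpa using Complex.abs_re_le_norm (meshPoint δ x)
      · simpa using Complex.abs_im_le_norm (meshPoint δ x)
    rw [abs_mul, abs_of_pos hδ] at h1
    linarith
  rw [mem_sqBox]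
  constructor <;> [have := kk 0; have := kk 1] <;>
  · simp only [Pi.zero_apply, sub_zero]
    have : (|x _| : ℝ) ≤ ⌈r₀ / δ⌉ := le_of_mul_le_mul_right (by nlinarith) hδ
    exact_mod_cast this

open Classical in
/-- **The flux identity.** Let `Λ = (n_bot → p_bot) ++ v ++ (p_top → n_top) ++ β` be a closed
walk of squares, `v` a walk of inner squares starting in the component of the base `p₀`, `β`
flux-free (every dart crosses a side with a point off `Ω`), and suppose the winding number of `Λ`
is `kT` at every face below-left of a vertex of `T` and `kB` at those of `B` (`T`, `B` the
Dirichlet vertex sets, disjoint, off which `h` is harmonic). Then the difference of the exit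
values is `(kT - kB)` times the total current out of `T`. [folklore] -/
theorem exitVal_sub_exitVal_eq (R : RandomPlanarGeometry.ConformalRectangle) (h0 : (0 : ℂ) ∈ R.carrier)
    (hδ : 0 < δ) {h : Site 2 → ℝ} {T B : Set (Site 2)} (hT : T ⊆ boundary R.carrier δ) (hB : B ⊆ boundary R.carrier δ)
    (hTB : Disjoint T B)
    (hharm : ∀ x, x ∉ T → x ∉ B →
      ∑ y ∈ ((zdGraph 2).neighborFinset x).filter (fun y => (domainGraph R.carrier δ).Adj x y), (h y - h x) = 0)
    {p₀ : Site 2} (hp₀ : IsInnerSq R.carrier δ p₀)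
    {nb pb pt nt : Site 2} (hb : (zdGraph 2).Adj nb pb) (ht : (zdGraph 2).Adj pt nt)
    (v : (zdGraph 2).Walk pb pt) (hv : ∀ z ∈ v.support, IsInnerSq R.carrier δ z) (hreach : (dualGraph R.carrier δ).Reachable p₀ pb)
    (β : (zdGraph 2).Walk nt nb) (hβ : ∀ d ∈ β.darts, ∃ w ∈ sideSeg δ d.fst d.snd, w ∉ R.carrier)
    (ST SB : Finset (Site 2)) (hST : ∀ u, u ∈ ST ↔ u + 1 ∈ T) (hSB : ∀ u, u ∈ SB ↔ u + 1 ∈ B)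
    {kT kB : ℤ} (hwT : ∀ u ∈ ST, walkWinding ((Walk.cons hb v).append (Walk.cons ht β)) u = kT)
    (hwB : ∀ u ∈ SB, walkWinding ((Walk.cons hb v).append (Walk.cons ht β)) u = kB) :
    exitVal R.carrier δ h p₀ pt nt - exitVal R.carrier δ h p₀ pb nb =
      ((kT - kB : ℤ) : ℝ) * ∑ u ∈ ST, divAt (curH R.carrier δ h) (curV R.carrier δ h) u := by
  obtain ⟨r₀, hr₀⟩ := (isBounded_iff_subset_closedBall (0 : ℂ)).1 R.isBounded
  set Λ := (Walk.cons hb v).append (Walk.cons ht β) with hΛ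
  -- the flux of `Λ`
  have hflux : walkFlux (curH R.carrier δ h) (curV R.carrier δ h) Λ =
      exitVal R.carrier δ h p₀ pt nt - exitVal R.carrier δ h p₀ pb nb := by
    rw [hΛ, walkFlux_append, walkFlux_cons, walkFlux_cons, walkFlux_eq_dualPot_sub R h0 hδ hT hB hharm hp₀ hreach v hv,
      walkFlux_eq_zero_of_sideSeg h β hβ, exitVal, exitVal, stepFlux_antisymm _ _ (stepKind_of_adj hb.symm)]
    ring
  -- the support of the currents
  set S : Finset (Site 2) := (sqBox_finite 0 (⌈r₀ / δ⌉ + 1)).toFinset with hS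
  have hSmem : ∀ u, u ∉ S → u ∉ sqBox 0 (⌈r₀ / δ⌉ + 1) := fun u hu hu' => hu ((Set.Finite.mem_toFinset _).2 hu')
  have hS1 : ∀ u ∉ S, curH R.carrier δ h u = 0 ∧ curV R.carrier δ h u = 0 := fun u hu =>
    (cur_eq_zero_of_not_mem_sqBox h0 hr₀ hδ h (hSmem u hu)).1
  have hS2 : ∀ u ∉ S, curH R.carrier δ h (u - Pi.single 0 1) = 0 ∧ curV R.carrier δ h (u - Pi.single 1 1) = 0 := fun u hu =>
    (cur_eq_zero_of_not_mem_sqBox h0 hr₀ hδ h (hSmem u hu)).2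
  -- `ST, SB ⊆ S`
  have hbox : ∀ u : Site 2, u + 1 ∈ boundary R.carrier δ → u ∈ S := by
    intro u hu
    have hd : u + 1 ∈ domain R.carrier δ := hu.1
    have hb' := mem_sqBox_of_mem_domain h0 hr₀ hδ hd
    rw [hS, Set.Finite.mem_toFinset, mem_sqBox]
    rw [mem_sqBox] at hb'
    simp only [Pi.zero_apply, sub_zero, Pi.add_apply, Pi.one_apply] at hb' ⊢
    constructor <;> [have := hb'.1; have := hb'.2] <;> rw [abs_le] at this ⊢ <;> omega
  have hTS : ST ⊆ S := fun u hu => hbox u (hT ((hST u).1 hu))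
  have hBS : SB ⊆ S := fun u hu => hbox u (hB ((hSB u).1 hu))
  have hdisj : Disjoint ST SB := by
    rw [Finset.disjoint_left]
    intro u hu hu'
    exact Set.disjoint_left.1 hTB ((hST u).1 hu) ((hSB u).1 hu')
  have hdiv : ∀ u ∈ S, u ∉ ST → u ∉ SB → divAt (curH R.carrier δ h) (curV R.carrier δ h) u = 0 := fun u _ h1 h2 =>
    divAt_cur_eq_zero hharm (fun h' => h1 ((hST u).2 h')) (fun h' => h2 ((hSB u).2 h'))
  rw [← hflux]
  exact walkFlux_eq_mul_sum_div hS1 hS2 hTS hBS hdisj hdiv Λ hwT hwB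

end FluxIdentity

/-! ### §W5. The winding numbers on the two sides of the cross differ by one -/

section WindingAcross

variable {a : Site 2}

/-- `vCrossSum` splits over a threefold concatenation. [folklore] -/
theorem vCrossSum_append3 {b c d : Site 2} (p : (zdGraph 2).Walk a b) (q : (zdGraph 2).Walk b c) (r : (zdGraph 2).Walk c d)
    (u : Site 2) : vCrossSum ((p.append q).append r) u = vCrossSum p u + vCrossSum q u + vCrossSum r u := by
  rw [vCrossSum_append, vCrossSum_append]

/-- **Winding difference across the cross.** Let `Λ = Λ₁ ++ (upward run from z, k steps) ++ Λ₂`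
be a closed walk and `P₁ : f_s → u`, `P₂ : u + m e₀ → f_e` walks of faces avoiding the squares of
`Λ`, the rightward run of `m` faces from `u` passing the column of the upward run at a level of
the run, the squares right of the run faces not visited by `Λ₁`, `Λ₂`. Then
`wind(Λ, f_s) - wind(Λ, f_e) = 1`. [folklore] -/
theorem walkWinding_sub_eq_one_of_cross {z : Site 2} {k : ℕ} (Λ₁ : (zdGraph 2).Walk a z)
    (Λ₂ : (zdGraph 2).Walk (z + (k : ℤ) • Pi.single 1 1) a)
    {fs fe u : Site 2} {m : ℕ} (P₁ : (zdGraph 2).Walk fs u) (P₂ : (zdGraph 2).Walk (u + (m : ℤ) • Pi.single 0 1) fe)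
    (hP₁ : ∀ w ∈ P₁.support, w ∉ ((Λ₁.append (upRun z k)).append Λ₂).support)
    (hP₂ : ∀ w ∈ P₂.support, w ∉ ((Λ₁.append (upRun z k)).append Λ₂).support)
    (hright : ∀ j < m, u + (j : ℤ) • Pi.single 0 1 + Pi.single 0 1 ∉ Λ₁.support ∧
      u + (j : ℤ) • Pi.single 0 1 + Pi.single 0 1 ∉ Λ₂.support)
    (hcol : u 0 + 1 ≤ z 0) (hcol' : z 0 ≤ u 0 + m) (hrow : z 1 ≤ u 1) (hrow' : u 1 + 1 ≤ z 1 + k) :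
    walkWinding ((Λ₁.append (upRun z k)).append Λ₂) fs - walkWinding ((Λ₁.append (upRun z k)).append Λ₂) fe = 1 := by
  set Λ := (Λ₁.append (upRun z k)).append Λ₂ with hΛ
  rw [walkWinding_eq_of_walk_closed Λ P₁ hP₁, ← walkWinding_eq_of_walk_closed Λ P₂ hP₂,
    walkWinding_sub_walkWinding_rightRun]
  have hterm : ∀ j ∈ Finset.range m, vCrossSum Λ (u + (j : ℤ) • Pi.single 0 1) =
      vCrossSum (upRun z k) (u + (j : ℤ) • Pi.single 0 1) := by
    intro j hj
    rw [Finset.mem_range] at hj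
    rw [hΛ, vCrossSum_append3, vCrossSum_eq_zero_of_not_mem_support (hright j hj).1,
      vCrossSum_eq_zero_of_not_mem_support (hright j hj).2]
    ring
  rw [Finset.sum_congr rfl hterm]
  have := walkWinding_upRun_sub z u k m hcol hcol' hrow hrow'
  rwa [walkWinding_sub_walkWinding_rightRun] at this

end WindingAcross

/-! ### §W6. Exits along a walk; face walks along a boundary arc -/

section ExitsAndFaceWalks

open WeakBeurling

variable {Ω : Set ℂ} {δ : ℝ}

/-- **Exit decomposition.** A walk of squares from the component `F₀` of the base to a square
outside it splits at an exit `(p, n)`: `p ∈ F₀`, `n ∉ F₀` adjacent, the initial piece inside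
`F₀`, and `n` a vertex of the walk. [folklore] -/
theorem exists_exit_decomp {p₀ c s : Site 2} (w : (zdGraph 2).Walk c s)
    (hc : (dualGraph Ω δ).Reachable p₀ c) (hs : ¬ (dualGraph Ω δ).Reachable p₀ s) :
    ∃ (p n : Site 2) (h : (zdGraph 2).Adj p n) (w₁ : (zdGraph 2).Walk c p) (w₂ : (zdGraph 2).Walk n s),
      w = w₁.append (Walk.cons h w₂) ∧ (∀ z ∈ w₁.support, (dualGraph Ω δ).Reachable p₀ z) ∧
      ¬ (dualGraph Ω δ).Reachable p₀ n ∧ n ∈ w.support ∧ (∀ z ∈ w₁.support, z ∈ w.support) := by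
  obtain ⟨p, n, h, w₁, w₂, hw, hF, hn⟩ := Walk.exists_first_exit (F := {q | (dualGraph Ω δ).Reachable p₀ q}) w hc hs
  refine ⟨p, n, h, w₁, w₂, hw, hF, hn, ?_, ?_⟩
  · rw [hw, Walk.support_append]; simp
  · intro z hz; rw [hw, Walk.support_append]; exact List.mem_append_left _ hz

/-- Adjacent lattice points have mesh points at distance `δ`. [folklore] -/
theorem dist_meshPoint_adj (hδ : 0 ≤ δ) {x y : Site 2} (hxy : (zdGraph 2).Adj x y) :
    dist (meshPoint δ x) (meshPoint δ y) = δ := by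
  rw [Complex.dist_eq]
  have hre : (meshPoint δ x - meshPoint δ y).re = δ * ((x 0 : ℝ) - y 0) := by simp [mul_sub]
  have him : (meshPoint δ x - meshPoint δ y).im = δ * ((x 1 : ℝ) - y 1) := by simp [mul_sub]
  rcases stepKind_of_adj hxy with ⟨h0, h1⟩ | ⟨h0, h1⟩ | ⟨h1, h0⟩ | ⟨h1, h0⟩
  · have e : meshPoint δ x - meshPoint δ y = ((-δ : ℝ) : ℂ) := by
      apply Complex.ext <;> simp [hre, him, h0, h1]
    rw [e, Complex.norm_real, Real.norm_eq_abs, abs_neg, abs_of_nonneg hδ]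
  · have e : meshPoint δ x - meshPoint δ y = ((δ : ℝ) : ℂ) := by
      apply Complex.ext <;> simp [hre, him, h0, h1]
    rw [e, Complex.norm_real, Real.norm_eq_abs, abs_of_nonneg hδ]
  · have e : meshPoint δ x - meshPoint δ y = ((-δ : ℝ) : ℂ) * Complex.I := by
      apply Complex.ext <;> simp [hre, him, h0, h1]
    rw [e, norm_mul, Complex.norm_I, mul_one, Complex.norm_real, Real.norm_eq_abs, abs_neg, abs_of_nonneg hδ]
  · have e : meshPoint δ x - meshPoint δ y = ((δ : ℝ) : ℂ) * Complex.I := by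
      apply Complex.ext <;> simp [hre, him, h0, h1]
    rw [e, norm_mul, Complex.norm_I, mul_one, Complex.norm_real, Real.norm_eq_abs, abs_of_nonneg hδ]

/-- A vertex of `A_n` is within `δ` of the arc `A`. [folklore] -/
theorem exists_mem_arc_dist_le (hδ : 0 ≤ δ) {A : Set ℂ} {x : Site 2} (hx : x ∈ arcVertices Ω δ A) :
    ∃ t ∈ A, dist (meshPoint δ x) t ≤ δ := by
  obtain ⟨-, y, hxy, t, htseg, htA⟩ := hx
  refine ⟨t, htA, ?_⟩
  have h1 : dist (meshPoint δ x) t ≤ dist (meshPoint δ x) (meshPoint δ y) := by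
    have := (convex_closedBall (meshPoint δ x) (dist (meshPoint δ x) (meshPoint δ y))).segment_subset
      (Metric.mem_closedBall_self dist_nonneg) (Metric.mem_closedBall.2 (by rw [_root_.dist_comm])) htseg
    rw [Metric.mem_closedBall] at this
    rwa [_root_.dist_comm] at this
  rw [dist_meshPoint_adj hδ hxy] at h1
  exact h1

/-- **Face walks along a boundary arc.** For a vertex `x` of `A_n` (`A = arc i`) and a point
`e = boundary σₑ` of the same arc, there is a walk of faces from the face `x - 1` (the square with
upper-right corner `x`) to the square of `e`, all of whose faces touch points within `2δ` of the
arc. [folklore] -/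
theorem exists_faceWalk_along_arc (R : RandomPlanarGeometry.ConformalRectangle) (hδ : 0 < δ) (i : Fin 4) {x : Site 2}
    (hx : x ∈ arcVertices R.carrier δ (R.arc i)) {σₑ : ℝ} (hσₑ : σₑ ∈ Icc (R.mark i) (R.nextMark i)) :
    ∃ P : (zdGraph 2).Walk (x - 1) (floorSq δ (R.boundary σₑ)),
      ∀ f ∈ P.support, ∃ w ∈ closedSq δ f, Metric.infDist w (R.arc i) ≤ 2 * δ := by
  classical
  obtain ⟨t, htA, hxt⟩ := exists_mem_arc_dist_le hδ.le hx
  obtain ⟨σₓ, hσₓ, rfl⟩ := htA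
  -- the centre of the face `x - 1`
  set c : ℂ := meshPoint δ x - (δ / 2 : ℝ) * (1 + Complex.I) with hc
  have hcsq : c ∈ closedSq δ (x - 1) := by
    refine ⟨?_, ?_, ?_, ?_⟩ <;> simp [hc, meshPoint] <;> nlinarith
  have hcx : dist c (meshPoint δ x) ≤ δ := by
    rw [hc, dist_eq_norm, show meshPoint δ x - (δ / 2 : ℝ) * (1 + Complex.I) - meshPoint δ x = -((δ / 2 : ℝ) * (1 + Complex.I)) by ring,
      norm_neg, norm_mul, Complex.norm_real, Real.norm_eq_abs, abs_of_pos (by positivity)]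
    have : ‖(1 : ℂ) + Complex.I‖ ≤ 2 := by
      calc ‖(1 : ℂ) + Complex.I‖ ≤ ‖(1 : ℂ)‖ + ‖Complex.I‖ := norm_add_le _ _
        _ = 2 := by simp; norm_num
    nlinarith
  -- first piece: the segment from `c` to the arc point
  set γ₁ : ℝ → ℂ := fun s => AffineMap.lineMap c (R.boundary σₓ) s with hγ₁
  have hγ₁c : ContinuousOn γ₁ (Icc 0 1) := AffineMap.lineMap_continuous.continuousOn
  have hγ₁0 : γ₁ 0 = c := by simp [hγ₁]
  have hγ₁1 : γ₁ 1 = R.boundary σₓ := by simp [hγ₁]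
  obtain ⟨S₁, -, hS₁⟩ := exists_dualWalk_of_path hδ zero_le_one hγ₁c (P := x - 1) (P' := floorSq δ (R.boundary σₓ))
    (by rw [hγ₁0]; exact hcsq) (by rw [hγ₁1]; exact mem_closedSq_floorSq hδ _)
  have hnear₁ : ∀ f ∈ S₁.support, ∃ w ∈ closedSq δ f, Metric.infDist w (R.arc i) ≤ 2 * δ := by
    intro f hf
    obtain ⟨s, hs, hγs⟩ := hS₁ f hf
    refine ⟨γ₁ s, hγs, ?_⟩
    have hmem : R.boundary σₓ ∈ R.arc i := ⟨σₓ, hσₓ, rfl⟩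
    refine (Metric.infDist_le_dist_of_mem hmem).trans ?_
    have hseg : γ₁ s ∈ segment ℝ c (R.boundary σₓ) := by
      rw [segment_eq_image_lineMap]; exact ⟨s, hs, rfl⟩
    have := (convex_closedBall (R.boundary σₓ) (2 * δ)).segment_subset ?_ (Metric.mem_closedBall_self (by positivity)) hseg
    · rwa [Metric.mem_closedBall] at this
    · rw [Metric.mem_closedBall]
      linarith [dist_triangle c (meshPoint δ x) (R.boundary σₓ)]
  -- second piece: along the arc
  have harc : ∀ {u v : ℝ}, u ≤ v → u ∈ Icc (R.mark i) (R.nextMark i) → v ∈ Icc (R.mark i) (R.nextMark i) →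
      ∃ S : (zdGraph 2).Walk (floorSq δ (R.boundary u)) (floorSq δ (R.boundary v)),
        ∀ f ∈ S.support, ∃ w ∈ closedSq δ f, Metric.infDist w (R.arc i) ≤ 2 * δ := by
    intro u v huv hu hv
    obtain ⟨S, -, hS⟩ := exists_dualWalk_of_path hδ huv (R.continuous_boundary.continuousOn)
      (P := floorSq δ (R.boundary u)) (P' := floorSq δ (R.boundary v)) (mem_closedSq_floorSq hδ _) (mem_closedSq_floorSq hδ _)
    refine ⟨S, fun f hf => ?_⟩
    obtain ⟨s, hs, hγs⟩ := hS f hf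
    refine ⟨R.boundary s, hγs, ?_⟩
    have : R.boundary s ∈ R.arc i := ⟨s, ⟨hu.1.trans hs.1, hs.2.trans hv.2⟩, rfl⟩
    rw [Metric.infDist_zero_of_mem this]; positivity
  rcases le_total σₓ σₑ with hle | hle
  · obtain ⟨S₂, hS₂⟩ := harc hle hσₓ hσₑ
    refine ⟨S₁.append S₂, fun f hf => ?_⟩
    rw [Walk.support_append] at hf
    rcases List.mem_append.1 hf with hf | hf
    · exact hnear₁ f hf
    · exact hS₂ f (List.tail_subset _ hf)
  · obtain ⟨S₂, hS₂⟩ := harc hle hσₑ hσₓ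
    refine ⟨S₁.append S₂.reverse, fun f hf => ?_⟩
    rw [Walk.support_append] at hf
    rcases List.mem_append.1 hf with hf | hf
    · exact hnear₁ f hf
    · exact hS₂ f (by have := List.tail_subset _ hf; rwa [Walk.support_reverse, List.mem_reverse] at this)

end ExitsAndFaceWalks

/-! ### §W7. The main lattice theorem: the flux between the exits at the ends of the crosscut -/

section MainLattice

open WeakBeurling

/-- Segments parametrized by `lineMap` are continuous with the expected end points and image.
[folklore] -/
theorem lineMap_props (P Q : ℂ) :
    ContinuousOn (fun s : ℝ => AffineMap.lineMap P Q s) (Icc 0 1) ∧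
    AffineMap.lineMap P Q (0 : ℝ) = P ∧ AffineMap.lineMap P Q (1 : ℝ) = Q ∧
    (fun s : ℝ => AffineMap.lineMap P Q s) '' Icc 0 1 = segment ℝ P Q := by
  refine ⟨AffineMap.lineMap_continuous.continuousOn, by simp, by simp, ?_⟩
  rw [segment_eq_image_lineMap]

/-- The floor square of a point given by coordinates. [folklore] -/
theorem floorSq_mk (δ x y : ℝ) : floorSq δ ⟨x, y⟩ = ![⌊x / δ⌋, ⌊y / δ⌋] := rfl


/-- The flux-free property of darts is preserved under reversal. [folklore] -/
theorem fluxFree_reverse {δ : ℝ} {Ω : Set ℂ} {a b : Site 2} {w : (zdGraph 2).Walk a b}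
    (hw : ∀ d ∈ w.darts, ∃ z ∈ sideSeg δ d.fst d.snd, z ∉ Ω) :
    ∀ d ∈ w.reverse.darts, ∃ z ∈ sideSeg δ d.fst d.snd, z ∉ Ω := by
  intro d hd
  rw [Walk.darts_reverse, List.mem_reverse, List.mem_map] at hd
  obtain ⟨d', hd', rfl⟩ := hd
  obtain ⟨z, hz, hzΩ⟩ := hw d' hd'
  exact ⟨z, by simpa [sideSeg_comm] using hz, hzΩ⟩

/-- The flux-free property of darts is preserved under concatenation. [folklore] -/
theorem fluxFree_append {δ : ℝ} {Ω : Set ℂ} {a b c : Site 2} {w : (zdGraph 2).Walk a b} {w' : (zdGraph 2).Walk b c}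
    (hw : ∀ d ∈ w.darts, ∃ z ∈ sideSeg δ d.fst d.snd, z ∉ Ω) (hw' : ∀ d ∈ w'.darts, ∃ z ∈ sideSeg δ d.fst d.snd, z ∉ Ω) :
    ∀ d ∈ (w.append w').darts, ∃ z ∈ sideSeg δ d.fst d.snd, z ∉ Ω := by
  intro d hd
  rw [Walk.darts_append, List.mem_append] at hd
  exact hd.elim (hw d) (hw' d)

/-- **Shadows of curves off `Ω` are flux-free and stay near the curve.** [folklore] -/
theorem exists_fluxFree_shadow {δ : ℝ} (hδ : 0 < δ) {Ω : Set ℂ} {γ : ℝ → ℂ} {a b : ℝ} (hab : a ≤ b)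
    (hγ : ContinuousOn γ (Icc a b)) (hγΩ : ∀ t ∈ Icc a b, γ t ∉ Ω) {P P' : Site 2} (hP : γ a ∈ closedSq δ P) (hP' : γ b ∈ closedSq δ P') :
    ∃ ω : (zdGraph 2).Walk P P', (∀ d ∈ ω.darts, ∃ z ∈ sideSeg δ d.fst d.snd, z ∉ Ω) ∧
      ∀ q ∈ ω.support, ∃ x ∈ γ '' Icc a b, x ∈ closedSq δ q := by
  obtain ⟨ω, hωd, hωs⟩ := exists_dualWalk_of_path hδ hab hγ hP hP'
  exact ⟨ω, fun d hd => by obtain ⟨t, ht, hγt⟩ := hωd d hd; exact ⟨γ t, hγt, hγΩ t ht⟩, fun q hq => near_of_shadow hωs hq⟩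

set_option maxHeartbeats 2000000 in
open Classical in
/-- **The flux between the exits at the ends of the crosscut is `±` the current out of `T`.**
Lattice part of the identification `W = ±I` ([GP19] §3, `h'(r) - h'(l) = I*`, on `ℤ²` without
planar duality): given the cross data of the conformal rectangle (two curves `Γ_V`, `Γ_H` in `Ω`
from the open arcs `1 → 3` and `jL → jR`, straightened near their crossing point as described in
`SquareTilingUniformization`), and exterior closing curves, for every small mesh and every
potential `h` harmonic off the disjoint Dirichlet sets `T_n, B_n`, the conjugate based at the
square of the crossing point has exits `(p_b, n_b)`, `(p_t, n_t)` within `η` of the end points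
`Γ_V 0`, `Γ_V 1`, and `E(p_t, n_t) - E(p_b, n_b) = σ Σ_{x ∈ T_n} (current out of x)` with
`σ = 1` if `jL = 0` and `σ = -1` if `jL = 2`. [cite: GeorgakopoulosPanagiotis2019, §3 (duality, on `ℤ²`)] -/
theorem exists_exits_flux_eq (R : RandomPlanarGeometry.ConformalRectangle) (h0 : (0 : ℂ) ∈ R.carrier)
    {ΓV ΓH : ℝ → ℂ} {c₀ : ℂ} {r xs ys tᵢ tₒ sᵢ sₒ : ℝ} {jL jR : Fin 4}
    (hVc : ContinuousOn ΓV (Icc 0 1)) (hHc : ContinuousOn ΓH (Icc 0 1))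
    (hV0 : ∃ σ ∈ Ioo (R.mark 1) (R.nextMark 1), ΓV 0 = R.boundary σ)
    (hV1 : ∃ σ ∈ Ioo (R.mark 3) (R.nextMark 3), ΓV 1 = R.boundary σ)
    (hH0 : ∃ σ ∈ Ioo (R.mark jL) (R.nextMark jL), ΓH 0 = R.boundary σ)
    (hH1 : ∃ σ ∈ Ioo (R.mark jR) (R.nextMark jR), ΓH 1 = R.boundary σ)
    (hLR : (jL = 0 ∧ jR = 2) ∨ (jL = 2 ∧ jR = 0))
    (hVΩ : ∀ t ∈ Ioo (0 : ℝ) 1, ΓV t ∈ R.carrier) (hHΩ : ∀ s ∈ Ioo (0 : ℝ) 1, ΓH s ∈ R.carrier)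
    (hr : 0 < r) (hballΩ : closedBall c₀ r ⊆ R.carrier)
    (htᵢ : 0 < tᵢ) (htᵢₒ : tᵢ < tₒ) (htₒ : tₒ < 1) (hsᵢ : 0 < sᵢ) (hsᵢₒ : sᵢ < sₒ) (hsₒ : sₒ < 1)
    (hxs : |xs - c₀.re| < r / 5) (hys : |ys - c₀.im| < r / 5)
    (hdisjA : Disjoint (ΓV '' Icc 0 tᵢ ∪ segment ℝ (ΓV tᵢ) ⟨xs, c₀.im - r / 2⟩ ∪ segment ℝ ⟨xs, c₀.im + r / 2⟩ (ΓV tₒ) ∪ ΓV '' Icc tₒ 1)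
      (ΓH '' Icc 0 sᵢ ∪ segment ℝ (ΓH sᵢ) ⟨c₀.re - r / 2, ys⟩ ∪ segment ℝ ⟨c₀.re - r / 2, ys⟩ ⟨c₀.re + r / 2, ys⟩ ∪
        segment ℝ ⟨c₀.re + r / 2, ys⟩ (ΓH sₒ) ∪ ΓH '' Icc sₒ 1))
    (hdisjB : Disjoint (ΓH '' Icc 0 sᵢ ∪ segment ℝ (ΓH sᵢ) ⟨c₀.re - r / 2, ys⟩ ∪ segment ℝ ⟨c₀.re + r / 2, ys⟩ (ΓH sₒ) ∪ ΓH '' Icc sₒ 1)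
      (ΓV '' Icc 0 tᵢ ∪ segment ℝ (ΓV tᵢ) ⟨xs, c₀.im - r / 2⟩ ∪ segment ℝ ⟨xs, c₀.im - r / 2⟩ ⟨xs, c₀.im + r / 2⟩ ∪
        segment ℝ ⟨xs, c₀.im + r / 2⟩ (ΓV tₒ) ∪ ΓV '' Icc tₒ 1))
    (hA234 : segment ℝ (ΓV tᵢ) ⟨xs, c₀.im - r / 2⟩ ∪ segment ℝ ⟨xs, c₀.im - r / 2⟩ ⟨xs, c₀.im + r / 2⟩ ∪
      segment ℝ ⟨xs, c₀.im + r / 2⟩ (ΓV tₒ) ⊆ closedBall c₀ r)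
    (hB234 : segment ℝ (ΓH sᵢ) ⟨c₀.re - r / 2, ys⟩ ∪ segment ℝ ⟨c₀.re - r / 2, ys⟩ ⟨c₀.re + r / 2, ys⟩ ∪
      segment ℝ ⟨c₀.re + r / 2, ys⟩ (ΓH sₒ) ⊆ closedBall c₀ r)
    (hVarc : ∀ t ∈ Icc (0 : ℝ) 1, ΓV t ∉ R.arc 0 ∧ ΓV t ∉ R.arc 2)
    {Et Eb M : ℝ → ℂ} (hEtc : ContinuousOn Et (Icc 1 2)) (hEbc : ContinuousOn Eb (Icc 1 2)) (hMc : ContinuousOn M (Icc 0 1))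
    (hEt1 : Et 1 = ΓV 1) (hEb1 : Eb 1 = ΓV 0) (hEt : ∀ t ∈ Ioc (1 : ℝ) 2, Et t ∈ (closure R.carrier)ᶜ)
    (hEb : ∀ t ∈ Ioc (1 : ℝ) 2, Eb t ∈ (closure R.carrier)ᶜ) (hM : ∀ s ∈ Icc (0 : ℝ) 1, M s ∈ (closure R.carrier)ᶜ)
    (hM0 : M 0 = Et 2) (hM1 : M 1 = Eb 2) {η : ℝ} (hη : 0 < η) :
    ∃ δ₀ > 0, ∀ δ, 0 < δ → δ < δ₀ → ∀ h : Site 2 → ℝ, ∀ hfin : (arcVertices R.carrier δ (R.arc 0)).Finite,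
      Disjoint (arcVertices R.carrier δ (R.arc 0)) (arcVertices R.carrier δ (R.arc 2)) →
      (∀ x, x ∉ arcVertices R.carrier δ (R.arc 0) → x ∉ arcVertices R.carrier δ (R.arc 2) →
        ∑ y ∈ ((zdGraph 2).neighborFinset x).filter (fun y => (domainGraph R.carrier δ).Adj x y), (h y - h x) = 0) →
      IsInnerSq R.carrier δ ![⌊xs / δ⌋, ⌊ys / δ⌋] ∧
      ∃ pb nb pt nt : Site 2, (zdGraph 2).Adj pb nb ∧ (zdGraph 2).Adj pt nt ∧
        (dualGraph R.carrier δ).Reachable ![⌊xs / δ⌋, ⌊ys / δ⌋] pb ∧ (dualGraph R.carrier δ).Reachable ![⌊xs / δ⌋, ⌊ys / δ⌋] pt ∧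
        ¬ (dualGraph R.carrier δ).Reachable ![⌊xs / δ⌋, ⌊ys / δ⌋] nb ∧ ¬ (dualGraph R.carrier δ).Reachable ![⌊xs / δ⌋, ⌊ys / δ⌋] nt ∧
        (∃ w ∈ closedSq δ nb, dist w (ΓV 0) < η) ∧ (∃ w ∈ closedSq δ nt, dist w (ΓV 1) < η) ∧
        exitVal R.carrier δ h ![⌊xs / δ⌋, ⌊ys / δ⌋] pt nt - exitVal R.carrier δ h ![⌊xs / δ⌋, ⌊ys / δ⌋] pb nb =
          (if jL = 0 then (1 : ℝ) else -1) *
            ∑ x ∈ hfin.toFinset, divAt (curH R.carrier δ h) (curV R.carrier δ h) (x - 1) := by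
  -- ### Step 0: notation and constants
  have hΩo : IsOpen R.carrier := R.isOpen
  have hΩc : IsConnected R.carrier := R.isConnected
  have hne : R.carrierᶜ.Nonempty := ⟨R.boundary 0, fun h =>
    (R.disjoint_carrier_frontier.ne_of_mem h (R.boundary_mem_frontier 0)) rfl⟩
  have hfrΩ : ∀ z ∈ frontier R.carrier, z ∉ R.carrier := fun z hz hzΩ =>
    Set.disjoint_left.1 R.disjoint_carrier_frontier hzΩ hz
  obtain ⟨σb, hσb, hqb⟩ := hV0
  obtain ⟨σt, hσt, hqt⟩ := hV1
  obtain ⟨σH0, hσH0, hH0eq⟩ := hH0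
  obtain ⟨σH1, hσH1, hH1eq⟩ := hH1
  set qb := ΓV 0 with hqbdef
  set qt := ΓV 1 with hqtdef
  have hqbfr : qb ∈ frontier R.carrier := by rw [hqb]; exact R.boundary_mem_frontier _
  have hqtfr : qt ∈ frontier R.carrier := by rw [hqt]; exact R.boundary_mem_frontier _
  -- the points of the cross
  set Qvm : ℂ := ⟨xs, c₀.im - r / 2⟩ with hQvm
  set Qvp : ℂ := ⟨xs, c₀.im + r / 2⟩ with hQvp
  set Qhm : ℂ := ⟨c₀.re - r / 2, ys⟩ with hQhm
  set Qhp : ℂ := ⟨c₀.re + r / 2, ys⟩ with hQhp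
  -- the pieces
  set A1 : Set ℂ := ΓV '' Icc 0 tᵢ with hA1
  set A2 : Set ℂ := segment ℝ (ΓV tᵢ) Qvm with hA2
  set A3 : Set ℂ := segment ℝ Qvm Qvp with hA3
  set A4 : Set ℂ := segment ℝ Qvp (ΓV tₒ) with hA4
  set A5 : Set ℂ := ΓV '' Icc tₒ 1 with hA5
  set B1 : Set ℂ := ΓH '' Icc 0 sᵢ with hB1
  set B2 : Set ℂ := segment ℝ (ΓH sᵢ) Qhm with hB2
  set B3 : Set ℂ := segment ℝ Qhm Qhp with hB3
  set B4 : Set ℂ := segment ℝ Qhp (ΓH sₒ) with hB4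
  set B5 : Set ℂ := ΓH '' Icc sₒ 1 with hB5
  set Aout : Set ℂ := A1 ∪ A2 ∪ A4 ∪ A5 with hAout
  set Aall : Set ℂ := A1 ∪ A2 ∪ A3 ∪ A4 ∪ A5 with hAall
  set Bout : Set ℂ := B1 ∪ B2 ∪ B4 ∪ B5 with hBout
  set Ball : Set ℂ := B1 ∪ B2 ∪ B3 ∪ B4 ∪ B5 with hBall
  have hA3sub : A3 ⊆ Aall := fun z hz => Or.inl (Or.inl (Or.inr hz))
  have hAoutsub : Aout ⊆ Aall := by
    rintro z (((h | h) | h) | h)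
    · exact Or.inl (Or.inl (Or.inl (Or.inl h)))
    · exact Or.inl (Or.inl (Or.inl (Or.inr h)))
    · exact Or.inl (Or.inr h)
    · exact Or.inr h
  have hB3sub : B3 ⊆ Ball := fun z hz => Or.inl (Or.inl (Or.inr hz))
  have hBoutsub : Bout ⊆ Ball := by
    rintro z (((h | h) | h) | h)
    · exact Or.inl (Or.inl (Or.inl (Or.inl h)))
    · exact Or.inl (Or.inl (Or.inl (Or.inr h)))
    · exact Or.inl (Or.inr h)
    · exact Or.inr h
  -- compactness
  have hIcc1 : ∀ {u v : ℝ}, 0 ≤ u → v ≤ 1 → Icc u v ⊆ Icc 0 1 := fun hu hv => Icc_subset_Icc hu hv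
  have hA1c : IsCompact A1 := (isCompact_Icc.image_of_continuousOn (hVc.mono (hIcc1 le_rfl (htᵢₒ.le.trans htₒ.le))))
  have hA5c : IsCompact A5 := (isCompact_Icc.image_of_continuousOn (hVc.mono (hIcc1 (htᵢ.le.trans htᵢₒ.le) le_rfl)))
  have hB1c : IsCompact B1 := (isCompact_Icc.image_of_continuousOn (hHc.mono (hIcc1 le_rfl (hsᵢₒ.le.trans hsₒ.le))))
  have hB5c : IsCompact B5 := (isCompact_Icc.image_of_continuousOn (hHc.mono (hIcc1 (hsᵢ.le.trans hsᵢₒ.le) le_rfl)))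
  have hsegc : ∀ P Q : ℂ, IsCompact (segment ℝ P Q) := fun P Q => by
    rw [segment_eq_image_lineMap]; exact isCompact_Icc.image AffineMap.lineMap_continuous
  have hAoutc : IsCompact Aout := ((hA1c.union (hsegc _ _)).union (hsegc _ _)).union hA5c
  have hAallc : IsCompact Aall := (((hA1c.union (hsegc _ _)).union (hsegc _ _)).union (hsegc _ _)).union hA5c
  have hBoutc : IsCompact Bout := ((hB1c.union (hsegc _ _)).union (hsegc _ _)).union hB5c
  have hBallc : IsCompact Ball := (((hB1c.union (hsegc _ _)).union (hsegc _ _)).union (hsegc _ _)).union hB5c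
  -- where the pieces live
  have hVcl : ∀ t ∈ Icc (0 : ℝ) 1, ΓV t ∈ closure R.carrier := by
    intro t ht
    rcases ht.1.eq_or_lt with h | h
    · rw [← h]; exact frontier_subset_closure hqbfr
    rcases ht.2.lt_or_eq with h' | h'
    · exact subset_closure (hVΩ t ⟨h, h'⟩)
    · rw [h']; exact frontier_subset_closure hqtfr
  have hH0fr : ΓH 0 ∈ frontier R.carrier := by rw [hH0eq]; exact R.boundary_mem_frontier _
  have hH1fr : ΓH 1 ∈ frontier R.carrier := by rw [hH1eq]; exact R.boundary_mem_frontier _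
  have hHcl : ∀ s ∈ Icc (0 : ℝ) 1, ΓH s ∈ closure R.carrier := by
    intro s hs
    rcases hs.1.eq_or_lt with h | h
    · rw [← h]; exact frontier_subset_closure hH0fr
    rcases hs.2.lt_or_eq with h' | h'
    · exact subset_closure (hHΩ s ⟨h, h'⟩)
    · rw [h']; exact frontier_subset_closure hH1fr
  have hballcl : closedBall c₀ r ⊆ closure R.carrier := hballΩ.trans subset_closure
  have hAall_cl : Aall ⊆ closure R.carrier := by
    rintro z ((((⟨t, ht, rfl⟩ | h) | h) | h) | ⟨t, ht, rfl⟩)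
    · exact hVcl t (hIcc1 le_rfl (htᵢₒ.le.trans htₒ.le) ht)
    · exact hballcl (hA234 (Or.inl (Or.inl h)))
    · exact hballcl (hA234 (Or.inl (Or.inr h)))
    · exact hballcl (hA234 (Or.inr h))
    · exact hVcl t (hIcc1 (htᵢ.le.trans htᵢₒ.le) le_rfl ht)
  have hBall_cl : Ball ⊆ closure R.carrier := by
    rintro z ((((⟨t, ht, rfl⟩ | h) | h) | h) | ⟨t, ht, rfl⟩)
    · exact hHcl t (hIcc1 le_rfl (hsᵢₒ.le.trans hsₒ.le) ht)
    · exact hballcl (hB234 (Or.inl (Or.inl h)))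
    · exact hballcl (hB234 (Or.inl (Or.inr h)))
    · exact hballcl (hB234 (Or.inr h))
    · exact hHcl t (hIcc1 (hsᵢ.le.trans hsᵢₒ.le) le_rfl ht)
  -- the frontier points of the pieces
  have hAall_fr : ∀ z ∈ Aall, z ∈ frontier R.carrier → z = qb ∨ z = qt := by
    rintro z ((((⟨t, ht, rfl⟩ | h) | h) | h) | ⟨t, ht, rfl⟩) hz
    · rcases ht.1.eq_or_lt with h | h
      · exact Or.inl (by rw [← h])
      · exact (hfrΩ _ hz (hVΩ t ⟨h, ht.2.trans_lt (htᵢₒ.trans htₒ)⟩)).elim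
    · exact (hfrΩ _ hz (hballΩ (hA234 (Or.inl (Or.inl h))))).elim
    · exact (hfrΩ _ hz (hballΩ (hA234 (Or.inl (Or.inr h))))).elim
    · exact (hfrΩ _ hz (hballΩ (hA234 (Or.inr h)))).elim
    · rcases ht.2.lt_or_eq with h | h
      · exact (hfrΩ _ hz (hVΩ t ⟨(htᵢ.trans htᵢₒ).trans_le ht.1, h⟩)).elim
      · exact Or.inr (by rw [h])
  have hBall_fr : ∀ z ∈ Ball, z ∈ frontier R.carrier → z = ΓH 0 ∨ z = ΓH 1 := by
    rintro z ((((⟨t, ht, rfl⟩ | h) | h) | h) | ⟨t, ht, rfl⟩) hz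
    · rcases ht.1.eq_or_lt with h | h
      · exact Or.inl (by rw [← h])
      · exact (hfrΩ _ hz (hHΩ t ⟨h, ht.2.trans_lt (hsᵢₒ.trans hsₒ)⟩)).elim
    · exact (hfrΩ _ hz (hballΩ (hB234 (Or.inl (Or.inl h))))).elim
    · exact (hfrΩ _ hz (hballΩ (hB234 (Or.inl (Or.inr h))))).elim
    · exact (hfrΩ _ hz (hballΩ (hB234 (Or.inr h)))).elim
    · rcases ht.2.lt_or_eq with h | h
      · exact (hfrΩ _ hz (hHΩ t ⟨(hsᵢ.trans hsᵢₒ).trans_le ht.1, h⟩)).elim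
      · exact Or.inr (by rw [h])
  -- `qb, qt` are not on the arcs `0, 2` nor on the `B`-pieces; `ΓH 0, ΓH 1` are on the arcs `0 ∪ 2`
  have hqarc : qb ∉ R.arc 0 ∧ qb ∉ R.arc 2 ∧ qt ∉ R.arc 0 ∧ qt ∉ R.arc 2 :=
    ⟨(hVarc 0 ⟨le_rfl, zero_le_one⟩).1, (hVarc 0 ⟨le_rfl, zero_le_one⟩).2, (hVarc 1 ⟨zero_le_one, le_rfl⟩).1, (hVarc 1 ⟨zero_le_one, le_rfl⟩).2⟩
  have hHarc : (ΓH 0 ∈ R.arc 0 ∨ ΓH 0 ∈ R.arc 2) ∧ (ΓH 1 ∈ R.arc 0 ∨ ΓH 1 ∈ R.arc 2) := by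
    have h0' : ΓH 0 ∈ R.arc jL := by rw [hH0eq]; exact ⟨σH0, Ioo_subset_Icc_self hσH0, rfl⟩
    have h1' : ΓH 1 ∈ R.arc jR := by rw [hH1eq]; exact ⟨σH1, Ioo_subset_Icc_self hσH1, rfl⟩
    rcases hLR with ⟨rfl, rfl⟩ | ⟨rfl, rfl⟩
    · exact ⟨Or.inl h0', Or.inr h1'⟩
    · exact ⟨Or.inr h0', Or.inl h1'⟩
  have hq_notB : qb ∉ Ball ∧ qt ∉ Ball := by
    constructor
    · intro h
      rcases hBall_fr _ h hqbfr with h' | h'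
      · rcases hHarc.1 with h'' | h'' <;> [exact hqarc.1 (h' ▸ h''); exact hqarc.2.1 (h' ▸ h'')]
      · rcases hHarc.2 with h'' | h'' <;> [exact hqarc.1 (h' ▸ h''); exact hqarc.2.1 (h' ▸ h'')]
    · intro h
      rcases hBall_fr _ h hqtfr with h' | h'
      · rcases hHarc.1 with h'' | h'' <;> [exact hqarc.2.2.1 (h' ▸ h''); exact hqarc.2.2.2 (h' ▸ h'')]
      · rcases hHarc.2 with h'' | h'' <;> [exact hqarc.2.2.1 (h' ▸ h''); exact hqarc.2.2.2 (h' ▸ h'')]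
  -- ### separation constants
  -- (1) `Aout` vs `Ball`, (2) `Bout` vs `Aall`
  obtain ⟨η₁, hη₁, hsep₁⟩ := exists_pos_forall_lt_dist hAoutc hBallc.isClosed hdisjA
  obtain ⟨η₂, hη₂, hsep₂⟩ := exists_pos_forall_lt_dist hBoutc hAallc.isClosed hdisjB
  -- (3) the arcs `0 ∪ 2` vs `Aall`
  have harcc : IsCompact (R.arc 0 ∪ R.arc 2) := (R.isCompact_arc 0).union (R.isCompact_arc 2)
  have hdisj3 : Disjoint (R.arc 0 ∪ R.arc 2) Aall := by
    rw [Set.disjoint_left]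
    rintro z hz hzA
    have hzfr : z ∈ frontier R.carrier := hz.elim (fun h => R.arc_subset_frontier 0 h) (fun h => R.arc_subset_frontier 2 h)
    rcases hAall_fr z hzA hzfr with rfl | rfl
    · exact hz.elim hqarc.1 hqarc.2.1
    · exact hz.elim hqarc.2.2.1 hqarc.2.2.2
  obtain ⟨η₃, hη₃, hsep₃⟩ := exists_pos_forall_lt_dist harcc hAallc.isClosed hdisj3
  -- (4) distances from `qb, qt` to the arcs `0 ∪ 2` and to `Ball`
  have hd₁ : ∃ d₁ > 0, ∀ z ∈ R.arc 0 ∪ R.arc 2, d₁ < dist z qb ∧ d₁ < dist z qt := by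
    have h1 : Disjoint (R.arc 0 ∪ R.arc 2) {qb, qt} := by
      rw [Set.disjoint_left]
      rintro z hz (rfl | rfl)
      · exact hz.elim hqarc.1 hqarc.2.1
      · exact hz.elim hqarc.2.2.1 hqarc.2.2.2
    obtain ⟨d, hd, hsep⟩ := exists_pos_forall_lt_dist harcc (Set.toFinite _).isClosed h1
    exact ⟨d, hd, fun z hz => ⟨hsep z hz qb (by simp), hsep z hz qt (by simp)⟩⟩
  obtain ⟨d₁, hd₁, hd₁sep⟩ := hd₁
  have hd₂ : ∃ d₂ > 0, ∀ z ∈ Ball, d₂ < dist z qb ∧ d₂ < dist z qt := by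
    have h1 : Disjoint Ball {qb, qt} := by
      rw [Set.disjoint_left]
      rintro z hz (rfl | rfl)
      · exact hq_notB.1 hz
      · exact hq_notB.2 hz
    obtain ⟨d, hd, hsep⟩ := exists_pos_forall_lt_dist hBallc (Set.toFinite _).isClosed h1
    exact ⟨d, hd, fun z hz => ⟨hsep z hz qb (by simp), hsep z hz qt (by simp)⟩⟩
  obtain ⟨d₂, hd₂, hd₂sep⟩ := hd₂
  -- (5) the exterior closing curves vs `Ball` and vs the arcs
  set Ext : Set ℂ := Et '' Icc 1 2 ∪ M '' Icc 0 1 ∪ Eb '' Icc 1 2 with hExt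
  have hExtc : IsCompact Ext :=
    ((isCompact_Icc.image_of_continuousOn hEtc).union (isCompact_Icc.image_of_continuousOn hMc)).union
      (isCompact_Icc.image_of_continuousOn hEbc)
  have hExt_mem : ∀ z ∈ Ext, z ∈ (closure R.carrier)ᶜ ∨ z = qt ∨ z = qb := by
    rintro z ((⟨t, ht, rfl⟩ | ⟨t, ht, rfl⟩) | ⟨t, ht, rfl⟩)
    · rcases ht.1.eq_or_lt with h | h
      · exact Or.inr (Or.inl (by rw [← h, hEt1]))
      · exact Or.inl (hEt t ⟨h, ht.2⟩)
    · exact Or.inl (hM t ht)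
    · rcases ht.1.eq_or_lt with h | h
      · exact Or.inr (Or.inr (by rw [← h, hEb1]))
      · exact Or.inl (hEb t ⟨h, ht.2⟩)
  have hExt_notΩ : ∀ z ∈ Ext, z ∉ R.carrier := by
    intro z hz hzΩ
    rcases hExt_mem z hz with h | rfl | rfl
    · exact h (subset_closure hzΩ)
    · exact hfrΩ _ hqtfr hzΩ
    · exact hfrΩ _ hqbfr hzΩ
  have hdisj5 : Disjoint Ext Ball := by
    rw [Set.disjoint_left]
    intro z hz hzB
    rcases hExt_mem z hz with h | rfl | rfl
    · exact h (hBall_cl hzB)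
    · exact hq_notB.2 hzB
    · exact hq_notB.1 hzB
  obtain ⟨η₅, hη₅, hsep₅⟩ := exists_pos_forall_lt_dist hExtc hBallc.isClosed hdisj5
  have hdisj6 : Disjoint Ext (R.arc 0 ∪ R.arc 2) := by
    rw [Set.disjoint_left]
    intro z hz hzA
    rcases hExt_mem z hz with h | rfl | rfl
    · exact h (frontier_subset_closure (hzA.elim (fun h => R.arc_subset_frontier 0 h) (fun h => R.arc_subset_frontier 2 h)))
    · exact hzA.elim hqarc.2.2.1 hqarc.2.2.2
    · exact hzA.elim hqarc.1 hqarc.2.1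
  obtain ⟨η₆, hη₆, hsep₆⟩ := exists_pos_forall_lt_dist hExtc harcc.isClosed hdisj6
  -- (6) the radius of the short boundary arcs and the corresponding closeness radius
  set r' : ℝ := min (min (d₁ / 2) (d₂ / 2)) (η / 2) with hr'
  have hr'0 : 0 < r' := by rw [hr']; positivity
  have hr'd₁ : r' ≤ d₁ / 2 := (min_le_left _ _).trans (min_le_left _ _)
  have hr'd₂ : r' ≤ d₂ / 2 := (min_le_left _ _).trans (min_le_right _ _)
  have hr'η : r' ≤ η / 2 := min_le_right _ _
  obtain ⟨ρ₁, hρ₁, hshort⟩ := exists_short_boundary_arc R.toJordanDomain hr'0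
  -- (7) the compact parts of `A1`, `A5` away from the end points are inside `Ω`
  set K₁ : Set ℂ := A1 ∩ (ball qb (min ρ₁ η / 2))ᶜ with hK₁
  set K₅ : Set ℂ := A5 ∩ (ball qt (min ρ₁ η / 2))ᶜ with hK₅
  have hK₁c : IsCompact K₁ := hA1c.inter_right isOpen_ball.isClosed_compl
  have hK₅c : IsCompact K₅ := hA5c.inter_right isOpen_ball.isClosed_compl
  have hK₁Ω : K₁ ⊆ R.carrier := by
    rintro z ⟨⟨t, ht, rfl⟩, hz⟩
    rcases ht.1.eq_or_lt with h | h
    · exfalso; apply hz; rw [← h]; exact mem_ball_self (by positivity)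
    · exact hVΩ t ⟨h, ht.2.trans_lt (htᵢₒ.trans htₒ)⟩
  have hK₅Ω : K₅ ⊆ R.carrier := by
    rintro z ⟨⟨t, ht, rfl⟩, hz⟩
    rcases ht.2.lt_or_eq with h | h
    · exact hVΩ t ⟨(htᵢ.trans htᵢₒ).trans_le ht.1, h⟩
    · exfalso; apply hz; rw [h]; exact mem_ball_self (by positivity)
  obtain ⟨δK₁, hδK₁, hinnK₁⟩ := exists_forall_isInnerSq_of_near hΩo hΩc hne h0 hK₁c hK₁Ω
  obtain ⟨δK₅, hδK₅, hinnK₅⟩ := exists_forall_isInnerSq_of_near hΩo hΩc hne h0 hK₅c hK₅Ω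
  obtain ⟨δKb, hδKb, hinnKb⟩ := exists_forall_isInnerSq_of_near hΩo hΩc hne h0 (isCompact_closedBall c₀ r) hballΩ
  -- ### the mesh bound
  set m₁ := min η₁ η₂ with hm₁
  set m₂ := min η₃ η₅ with hm₂
  set m₃ := min η₆ (d₁ / 2) with hm₃
  set m₄ := min (d₂ / 2) (min ρ₁ η) with hm₄
  set m₅ := min δK₁ δK₅ with hm₅
  set m₆ := min δKb r with hm₆
  set M₁ := min m₁ m₂ with hM₁
  set M₂ := min m₃ m₄ with hM₂
  set M₃ := min m₅ m₆ with hM₃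
  set δ₀ : ℝ := min (min M₁ M₂) M₃ / 16 with hδ₀
  have hδ₀pos : 0 < δ₀ := by rw [hδ₀]; positivity
  refine ⟨δ₀, hδ₀pos, fun δ hδ hδlt h hfin hTBn hharm => ?_⟩
  have hMM : 16 * δ < min (min M₁ M₂) M₃ := by rw [hδ₀] at hδlt; linarith
  have hδη₁ : 16 * δ < η₁ := hMM.trans_le ((min_le_left _ _).trans ((min_le_left _ _).trans ((min_le_left _ _).trans (min_le_left _ _))))
  have hδη₂ : 16 * δ < η₂ := hMM.trans_le ((min_le_left _ _).trans ((min_le_left _ _).trans ((min_le_left _ _).trans (min_le_right _ _))))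
  have hδη₃ : 16 * δ < η₃ := hMM.trans_le ((min_le_left _ _).trans ((min_le_left _ _).trans ((min_le_right _ _).trans (min_le_left _ _))))
  have hδη₅ : 16 * δ < η₅ := hMM.trans_le ((min_le_left _ _).trans ((min_le_left _ _).trans ((min_le_right _ _).trans (min_le_right _ _))))
  have hδη₆ : 16 * δ < η₆ := hMM.trans_le ((min_le_left _ _).trans ((min_le_right _ _).trans ((min_le_left _ _).trans (min_le_left _ _))))
  have hδd₁ : 16 * δ < d₁ / 2 := hMM.trans_le ((min_le_left _ _).trans ((min_le_right _ _).trans ((min_le_left _ _).trans (min_le_right _ _))))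
  have hδd₂ : 16 * δ < d₂ / 2 := hMM.trans_le ((min_le_left _ _).trans ((min_le_right _ _).trans ((min_le_right _ _).trans (min_le_left _ _))))
  have hδρ₁ : 16 * δ < min ρ₁ η := hMM.trans_le ((min_le_left _ _).trans ((min_le_right _ _).trans ((min_le_right _ _).trans (min_le_right _ _))))
  have hδK₁' : δ < δK₁ := by
    have := hMM.trans_le ((min_le_right _ _).trans ((min_le_left _ _).trans (min_le_left _ _))); linarith
  have hδK₅' : δ < δK₅ := by
    have := hMM.trans_le ((min_le_right _ _).trans ((min_le_left _ _).trans (min_le_right _ _))); linarith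
  have hδKb' : δ < δKb := by
    have := hMM.trans_le ((min_le_right _ _).trans ((min_le_right _ _).trans (min_le_left _ _))); linarith
  have hδr : 16 * δ < r := hMM.trans_le ((min_le_right _ _).trans ((min_le_right _ _).trans (min_le_right _ _)))
  -- ### Step 1: indices, the column, shadows
  set Xs : ℤ := ⌊xs / δ⌋ with hXs
  set Ys : ℤ := ⌊ys / δ⌋ with hYs
  set Ym : ℤ := ⌊(c₀.im - r / 2) / δ⌋ with hYm
  set Yp : ℤ := ⌊(c₀.im + r / 2) / δ⌋ with hYp
  set Xm : ℤ := ⌊(c₀.re - r / 2) / δ⌋ with hXm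
  set Xp : ℤ := ⌊(c₀.re + r / 2) / δ⌋ with hXp
  have hxs' := abs_lt.1 hxs
  have hys' := abs_lt.1 hys
  -- floor arithmetic
  have hfl : ∀ {u v : ℝ}, u + 2 * δ ≤ v → ⌊u / δ⌋ + 1 ≤ ⌊v / δ⌋ := by
    intro u v huv
    have : u / δ + 2 ≤ v / δ := by rw [div_add' _ _ _ hδ.ne', div_le_div_iff_of_pos_right hδ]; linarith
    have h1 := Int.floor_le_floor this
    rw [show u / δ + 2 = u / δ + ((2 : ℤ) : ℝ) by push_cast; ring, Int.floor_add_intCast] at h1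
    omega
  have hflm : ∀ {u v : ℝ}, u ≤ v → ⌊u / δ⌋ ≤ ⌊v / δ⌋ := fun huv => Int.floor_le_floor (div_le_div_of_nonneg_right huv hδ.le)
  have hYmYs : Ym + 1 ≤ Ys := hfl (by linarith)
  have hYsYp : Ys + 1 ≤ Yp := hfl (by linarith)
  have hXmXs : Xm + 1 ≤ Xs := hfl (by linarith)
  have hXsXp : Xs + 1 ≤ Xp := hfl (by linarith)
  have hYmp : Ym ≤ Yp := by omega
  have hXmp : Xm ≤ Xp := by omega
  set k : ℕ := (Yp - Ym).toNat with hk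
  have hkz : (k : ℤ) = Yp - Ym := Int.toNat_of_nonneg (by omega)
  set m : ℕ := (Xp - Xm).toNat with hm
  have hmz : (m : ℤ) = Xp - Xm := Int.toNat_of_nonneg (by omega)
  set Cm : Site 2 := ![Xs, Ym] with hCm
  set p₀ : Site 2 := ![Xs, Ys] with hp₀def
  have hp₀eq : (![⌊xs / δ⌋, ⌊ys / δ⌋] : Site 2) = p₀ := rfl
  have hCmfl : floorSq δ Qvm = Cm := by rw [hQvm, floorSq_mk]
  have hCpfl : Cm + (k : ℤ) • (Pi.single 1 1 : Site 2) = floorSq δ Qvp := by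
    rw [hQvp, floorSq_mk]; ext i; fin_cases i <;> simp [hCm, hkz, hYp, hXs]
  set ur : Site 2 := ![Xm, Ys] with hur
  have hurfl : floorSq δ Qhm = ur := by rw [hQhm, floorSq_mk]
  have hurpfl : ur + (m : ℤ) • (Pi.single 0 1 : Site 2) = floorSq δ Qhp := by
    rw [hQhp, floorSq_mk]; ext i; fin_cases i <;> simp [hur, hmz, hXp, hYs]
  -- points of the closed ball and the inner squares touching it
  have hinK : ∀ q : Site 2, (∃ w ∈ closedBall c₀ r, w ∈ closedSq δ q) → IsInnerSq R.carrier δ q := hinnKb δ hδ hδKb'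
  have hcolpt : ∀ y : ℤ, Ym ≤ y → y ≤ Yp → (⟨xs, ((y : ℝ) + 1 / 2) * δ⟩ : ℂ) ∈ closedBall c₀ r := by
    intro y hy1 hy2
    have hlo : c₀.im - r / 2 < ((Ym : ℝ) + 1) * δ := by
      have := Int.lt_floor_add_one ((c₀.im - r / 2) / δ); rwa [div_lt_iff₀ hδ] at this
    have hhi : (Yp : ℝ) * δ ≤ c₀.im + r / 2 := by
      have := Int.floor_le ((c₀.im + r / 2) / δ); rwa [le_div_iff₀ hδ] at this
    have hyy1 : (Ym : ℝ) * δ ≤ (y : ℝ) * δ := mul_le_mul_of_nonneg_right (by exact_mod_cast hy1) hδ.le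
    have hyy2 : (y : ℝ) * δ ≤ (Yp : ℝ) * δ := mul_le_mul_of_nonneg_right (by exact_mod_cast hy2) hδ.le
    have hb : |((y : ℝ) + 1 / 2) * δ - c₀.im| ≤ r / 2 + δ := by rw [abs_le]; constructor <;> linarith
    have hb2 : (((y : ℝ) + 1 / 2) * δ - c₀.im) ^ 2 ≤ (r / 2 + δ) ^ 2 := by
      rw [← sq_abs]; exact pow_le_pow_left₀ (abs_nonneg _) hb 2
    have ha2 : (xs - c₀.re) ^ 2 ≤ (r / 5) ^ 2 := by
      rw [← sq_abs]; exact pow_le_pow_left₀ (abs_nonneg _) hxs.le 2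
    have hsum : (r / 5) ^ 2 + (r / 2 + δ) ^ 2 ≤ r ^ 2 := by nlinarith
    rw [Metric.mem_closedBall, Complex.dist_eq, Complex.norm_def, Real.sqrt_le_left hr.le, Complex.normSq_apply]
    have e1 : ((⟨xs, ((y : ℝ) + 1 / 2) * δ⟩ : ℂ) - c₀).re = xs - c₀.re := by simp
    have e2 : ((⟨xs, ((y : ℝ) + 1 / 2) * δ⟩ : ℂ) - c₀).im = ((y : ℝ) + 1 / 2) * δ - c₀.im := by simp
    rw [e1, e2, ← sq, ← sq]
    linarith
  have hcol_inner : ∀ q ∈ (upRun Cm k).support, IsInnerSq R.carrier δ q := by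
    intro q hq
    rw [mem_support_upRun] at hq
    obtain ⟨hq0, hq1, hq2⟩ := hq
    have hqeq : q = ![Xs, q 1] := by ext i; fin_cases i <;> simp [hq0, hCm]
    have hy1 : Ym ≤ q 1 := by simpa [hCm] using hq1
    have hy2 : q 1 ≤ Yp := by have := hq2; simp [hCm] at this; omega
    refine hinK q ⟨_, hcolpt (q 1) hy1 hy2, ?_⟩
    rw [hqeq, hXs]; exact mem_closedSq_col hδ xs (q 1)
  have hp₀col : p₀ ∈ (upRun Cm k).support := by
    rw [mem_support_upRun]; simp [hp₀def, hCm]; omega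
  have hp₀inner : IsInnerSq R.carrier δ p₀ := hcol_inner p₀ hp₀col
  have hcol_reach : ∀ q ∈ (upRun Cm k).support, (dualGraph R.carrier δ).Reachable p₀ q := fun q hq =>
    reachable_of_mem_support_inner (upRun Cm k) hcol_inner hp₀col hq
  -- reachable squares are inner; exits are not inner
  have hreach_inner : ∀ {q : Site 2}, (dualGraph R.carrier δ).Reachable p₀ q → IsInnerSq R.carrier δ q := fun hq => by
    obtain ⟨W⟩ := hq; exact isInnerSq_of_mem_support' hp₀inner W (Walk.end_mem_support _)
  have hexit_notinner : ∀ {p n : Site 2}, (dualGraph R.carrier δ).Reachable p₀ p → (zdGraph 2).Adj p n →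
      ¬ (dualGraph R.carrier δ).Reachable p₀ n → ¬ IsInnerSq R.carrier δ n := fun hp hpn hn hnI =>
    hn (hp.trans (dualGraph_adj_iff.2 ⟨hpn, hreach_inner hp, hnI⟩).reachable)
  have hfloor_notreach : ∀ {z : ℂ}, z ∉ R.carrier → ¬ (dualGraph R.carrier δ).Reachable p₀ (floorSq δ z) := fun hz hr' =>
    not_isInnerSq_of_mem_closedSq R hδ (mem_closedSq_floorSq hδ _) hz (hreach_inner hr')
  -- shadows of the five pieces of `Γ_V` (with the straight middle as an upward run)
  obtain ⟨ω₁, -, hω₁s⟩ := exists_dualWalk_of_path hδ htᵢ.le (hVc.mono (hIcc1 le_rfl (htᵢₒ.le.trans htₒ.le)))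
    (P := floorSq δ qb) (P' := floorSq δ (ΓV tᵢ)) (mem_closedSq_floorSq hδ _) (mem_closedSq_floorSq hδ _)
  obtain ⟨hL₂c, hL₂0, hL₂1, hL₂im⟩ := lineMap_props (ΓV tᵢ) Qvm
  obtain ⟨ω₂, -, hω₂s⟩ := exists_dualWalk_of_path hδ zero_le_one hL₂c (P := floorSq δ (ΓV tᵢ)) (P' := Cm)
    (by show AffineMap.lineMap _ _ (0 : ℝ) ∈ _; rw [hL₂0]; exact mem_closedSq_floorSq hδ _)
    (by show AffineMap.lineMap _ _ (1 : ℝ) ∈ _; rw [hL₂1, ← hCmfl]; exact mem_closedSq_floorSq hδ _)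
  obtain ⟨hL₄c, hL₄0, hL₄1, hL₄im⟩ := lineMap_props Qvp (ΓV tₒ)
  obtain ⟨ω₄, -, hω₄s⟩ := exists_dualWalk_of_path hδ zero_le_one hL₄c (P := floorSq δ Qvp) (P' := floorSq δ (ΓV tₒ))
    (by show AffineMap.lineMap _ _ (0 : ℝ) ∈ _; rw [hL₄0]; exact mem_closedSq_floorSq hδ _)
    (by show AffineMap.lineMap _ _ (1 : ℝ) ∈ _; rw [hL₄1]; exact mem_closedSq_floorSq hδ _)
  obtain ⟨ω₅, -, hω₅s⟩ := exists_dualWalk_of_path hδ htₒ.le (hVc.mono (hIcc1 (htᵢ.le.trans htᵢₒ.le) le_rfl))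
    (P := floorSq δ (ΓV tₒ)) (P' := floorSq δ qt) (mem_closedSq_floorSq hδ _) (mem_closedSq_floorSq hδ _)
  have hnear₁ : ∀ q ∈ ω₁.support, ∃ x ∈ A1, x ∈ closedSq δ q := fun q hq => near_of_shadow hω₁s hq
  have hnear₂ : ∀ q ∈ ω₂.support, ∃ x ∈ A2, x ∈ closedSq δ q := fun q hq => by
    have := near_of_shadow hω₂s hq; rwa [hL₂im] at this
  have hnear₄ : ∀ q ∈ ω₄.support, ∃ x ∈ A4, x ∈ closedSq δ q := fun q hq => by
    have := near_of_shadow hω₄s hq; rwa [hL₄im] at this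
  have hnear₅ : ∀ q ∈ ω₅.support, ∃ x ∈ A5, x ∈ closedSq δ q := fun q hq => near_of_shadow hω₅s hq
  have hnear₃ : ∀ q ∈ (upRun Cm k).support, ∃ x ∈ A3, x ∈ closedSq δ q := by
    intro q hq
    rw [mem_support_upRun] at hq
    obtain ⟨hq0, hq1, hq2⟩ := hq
    have hqeq : q = ![Xs, q 1] := by ext i; fin_cases i <;> simp [hq0, hCm]
    have hy1 : Ym ≤ q 1 := by simpa [hCm] using hq1
    have hy2 : q 1 ≤ Yp := by have := hq2; simp [hCm] at this; omega
    -- a point of `A3` in the square: the line `re = xs` at a height clamped to the segment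
    set yy : ℝ := max (c₀.im - r / 2) (min (c₀.im + r / 2) (((q 1 : ℝ) + 1 / 2) * δ)) with hyy
    have hyy1 : c₀.im - r / 2 ≤ yy := le_max_left _ _
    have hyy2 : yy ≤ c₀.im + r / 2 := max_le (by linarith) (min_le_left _ _)
    refine ⟨⟨xs, yy⟩, ?_, ?_⟩
    · -- on the vertical segment
      rw [hA3, hQvm, hQvp]
      refine ⟨(c₀.im + r / 2 - yy) / r, (yy - (c₀.im - r / 2)) / r, by positivity, by positivity, by field_simp; ring, ?_⟩
      apply Complex.ext <;> simp <;> field_simp <;> ring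
    · -- in the square
      have h1 : (Ym : ℝ) * δ ≤ c₀.im - r / 2 := by
        have := Int.floor_le ((c₀.im - r / 2) / δ); rwa [le_div_iff₀ hδ] at this
      have h3 : (Yp : ℝ) * δ ≤ c₀.im + r / 2 := by
        have := Int.floor_le ((c₀.im + r / 2) / δ); rwa [le_div_iff₀ hδ] at this
      have h4 : c₀.im - r / 2 < ((Ym : ℝ) + 1) * δ := by
        have := Int.lt_floor_add_one ((c₀.im - r / 2) / δ); rwa [div_lt_iff₀ hδ] at this
      have hq1r : δ * (Ym : ℝ) ≤ δ * (q 1 : ℝ) := mul_le_mul_of_nonneg_left (by exact_mod_cast hy1) hδ.le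
      have hq2r : δ * (q 1 : ℝ) ≤ δ * (Yp : ℝ) := mul_le_mul_of_nonneg_left (by exact_mod_cast hy2) hδ.le
      have hx := mem_closedSq_col hδ xs (q 1)
      rw [← hXs] at hx
      obtain ⟨hx1, hx2, -, -⟩ := hx
      rw [hqeq]
      refine ⟨by simpa using hx1, by simpa using hx2, ?_, ?_⟩ <;> simp only [Matrix.cons_val_one, Matrix.cons_val_fin_one]
      · show δ * (q 1 : ℝ) ≤ yy
        rw [hyy]
        exact le_max_of_le_right (le_min (by linarith) (by nlinarith))
      · show yy ≤ δ * ((q 1 : ℝ) + 1)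
        rw [hyy]
        exact max_le (by linarith) ((min_le_right _ _).trans (by nlinarith))
  -- ### Step 2: the exits
  set ωR := ω₄.append ω₅ with hωR
  set ωL := (ω₁.append ω₂).reverse with hωL
  have hstartR : (dualGraph R.carrier δ).Reachable p₀ (floorSq δ Qvp) := by
    rw [← hCpfl]; exact hcol_reach _ (Walk.end_mem_support _)
  have hstartL : (dualGraph R.carrier δ).Reachable p₀ Cm := hcol_reach _ (Walk.start_mem_support _)
  have hqbΩ : qb ∉ R.carrier := hfrΩ _ hqbfr
  have hqtΩ : qt ∉ R.carrier := hfrΩ _ hqtfr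
  obtain ⟨pt, nt, hptnt, u₁, u₂, hωRdec, hu₁F, hntF, hnt_supp, hu₁supp⟩ := exists_exit_decomp ωR hstartR (hfloor_notreach hqtΩ)
  obtain ⟨pb, nb, hpbnb, w₁, w₂, hωLdec, hw₁F, hnbF, hnb_supp, hw₁supp⟩ := exists_exit_decomp ωL hstartL (hfloor_notreach hqbΩ)
  have hptF : (dualGraph R.carrier δ).Reachable p₀ pt := hu₁F _ (Walk.end_mem_support _)
  have hpbF : (dualGraph R.carrier δ).Reachable p₀ pb := hw₁F _ (Walk.end_mem_support _)
  have hnt_ni : ¬ IsInnerSq R.carrier δ nt := hexit_notinner hptF hptnt hntF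
  have hnb_ni : ¬ IsInnerSq R.carrier δ nb := hexit_notinner hpbF hpbnb hnbF
  -- the exit squares touch `A5` (resp. `A1`) near `qt` (resp. `qb`)
  have hnt_near : ∃ w ∈ closedSq δ nt, w ∈ A5 ∧ dist w qt < min ρ₁ η / 2 := by
    rw [hωR, Walk.support_append] at hnt_supp
    rcases List.mem_append.1 hnt_supp with h4 | h5
    · obtain ⟨x, hx, hxq⟩ := hnear₄ nt h4
      exact (hnt_ni (hinK nt ⟨x, hA234 (Or.inr hx), hxq⟩)).elim
    · obtain ⟨x, hx, hxq⟩ := hnear₅ nt (List.tail_subset _ h5)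
      refine ⟨x, hxq, hx, ?_⟩
      by_contra hfar
      push Not at hfar
      exact hnt_ni (hinnK₅ δ hδ hδK₅' nt ⟨x, ⟨hx, fun hb => by rw [Metric.mem_ball] at hb; linarith⟩, hxq⟩)
  have hnb_near : ∃ w ∈ closedSq δ nb, w ∈ A1 ∧ dist w qb < min ρ₁ η / 2 := by
    rw [hωL, Walk.support_reverse, List.mem_reverse, Walk.support_append] at hnb_supp
    rcases List.mem_append.1 hnb_supp with h1 | h2
    · obtain ⟨x, hx, hxq⟩ := hnear₁ nb h1
      refine ⟨x, hxq, hx, ?_⟩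
      by_contra hfar
      push Not at hfar
      exact hnb_ni (hinnK₁ δ hδ hδK₁' nb ⟨x, ⟨hx, fun hb => by rw [Metric.mem_ball] at hb; linarith⟩, hxq⟩)
    · obtain ⟨x, hx, hxq⟩ := hnear₂ nb (List.tail_subset _ h2)
      exact (hnb_ni (hinK nb ⟨x, hA234 (Or.inl (Or.inl hx)), hxq⟩)).elim
  -- ### Step 3: closing the loop through the boundary arcs and the exterior
  obtain ⟨jt, hjt_sq, hjt_fr⟩ := exists_mem_frontier_of_adj_not_isInnerSq R hδ (hreach_inner hptF) hptnt hnt_ni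
  obtain ⟨jb, hjb_sq, hjb_fr⟩ := exists_mem_frontier_of_adj_not_isInnerSq R hδ (hreach_inner hpbF) hpbnb hnb_ni
  have hδρη : 2 * δ + min ρ₁ η / 2 < min ρ₁ η := by linarith [hδρ₁]
  have hjt_dist : dist jt qt < min ρ₁ η := by
    obtain ⟨w, hw, -, hwd⟩ := hnt_near
    linarith [dist_triangle jt w qt, dist_le_of_mem_closedSq hjt_sq hw]
  have hjb_dist : dist jb qb < min ρ₁ η := by
    obtain ⟨w, hw, -, hwd⟩ := hnb_near
    linarith [dist_triangle jb w qb, dist_le_of_mem_closedSq hjb_sq hw]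
  -- the boundary arcs
  set ArcT : Set ℂ := {z ∈ frontier R.carrier | dist z qt < r'} with hArcT
  set ArcB : Set ℂ := {z ∈ frontier R.carrier | dist z qb < r'} with hArcB
  have harcwalk : ∀ {j q : ℂ} {σ : ℝ} (n : Site 2), q = R.boundary σ → j ∈ closedSq δ n → j ∈ frontier R.carrier →
      dist j q < ρ₁ →
      ∃ κ : (zdGraph 2).Walk n (floorSq δ q), (∀ d ∈ κ.darts, ∃ z ∈ sideSeg δ d.fst d.snd, z ∉ R.carrier) ∧
        ∀ s ∈ κ.support, ∃ x ∈ {z ∈ frontier R.carrier | dist z q < r'}, x ∈ closedSq δ s := by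
    intro j q σ n hqσ hjn hjfr hdist
    have hqfr : q ∈ frontier R.carrier := by rw [hqσ]; exact R.boundary_mem_frontier σ
    obtain ⟨a₁, a₂, ha, hends, harc⟩ := hshort σ j q hjfr hqfr (by rwa [← hqσ]) (by rw [← hqσ, _root_.dist_self]; exact hρ₁)
    have hcont : ContinuousOn R.boundary (Icc a₁ a₂) := R.continuous_boundary.continuousOn
    have hnotΩ : ∀ t ∈ Icc a₁ a₂, R.boundary t ∉ R.carrier := fun t _ => hfrΩ _ (R.boundary_mem_frontier t)
    have hnear : ∀ {s : Site 2}, (∃ x ∈ R.boundary '' Icc a₁ a₂, x ∈ closedSq δ s) →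
        ∃ x ∈ {z ∈ frontier R.carrier | dist z q < r'}, x ∈ closedSq δ s := by
      intro s hs
      obtain ⟨_, ⟨t, ht, rfl⟩, hx⟩ := hs
      exact ⟨_, ⟨R.boundary_mem_frontier t, by rw [hqσ]; exact harc t ht⟩, hx⟩
    rcases hends with ⟨h1, h2⟩ | ⟨h1, h2⟩
    · obtain ⟨κ, hκd, hκs⟩ := exists_fluxFree_shadow hδ ha hcont hnotΩ (P := n) (P' := floorSq δ q)
        (by rw [h1]; exact hjn) (by rw [h2]; exact mem_closedSq_floorSq hδ q)
      exact ⟨κ, hκd, fun s hs => hnear (hκs s hs)⟩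
    · obtain ⟨κ, hκd, hκs⟩ := exists_fluxFree_shadow hδ ha hcont hnotΩ (P := floorSq δ q) (P' := n)
        (by rw [h1]; exact mem_closedSq_floorSq hδ q) (by rw [h2]; exact hjn)
      exact ⟨κ.reverse, fluxFree_reverse hκd, fun s hs => hnear (hκs s (by rwa [Walk.support_reverse, List.mem_reverse] at hs))⟩
  obtain ⟨κt, hκtd, hκts⟩ := harcwalk nt hqt hjt_sq hjt_fr (hjt_dist.trans_le (min_le_left _ _))
  obtain ⟨κb, hκbd, hκbs⟩ := harcwalk nb hqb hjb_sq hjb_fr (hjb_dist.trans_le (min_le_left _ _))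
  -- the exterior pieces
  have hIcc12 : (1 : ℝ) ≤ 2 := by norm_num
  have hEtΩ : ∀ t ∈ Icc (1 : ℝ) 2, Et t ∉ R.carrier := fun t ht => hExt_notΩ _ (Or.inl (Or.inl ⟨t, ht, rfl⟩))
  have hEbΩ : ∀ t ∈ Icc (1 : ℝ) 2, Eb t ∉ R.carrier := fun t ht => hExt_notΩ _ (Or.inr ⟨t, ht, rfl⟩)
  have hMΩ : ∀ t ∈ Icc (0 : ℝ) 1, M t ∉ R.carrier := fun t ht => hExt_notΩ _ (Or.inl (Or.inr ⟨t, ht, rfl⟩))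
  obtain ⟨κE, hκEd, hκEs⟩ := exists_fluxFree_shadow hδ hIcc12 hEtc hEtΩ (P := floorSq δ qt) (P' := floorSq δ (Et 2))
    (by rw [hEt1]; exact mem_closedSq_floorSq hδ _) (mem_closedSq_floorSq hδ _)
  obtain ⟨κM, hκMd, hκMs⟩ := exists_fluxFree_shadow hδ zero_le_one hMc hMΩ (P := floorSq δ (Et 2)) (P' := floorSq δ (Eb 2))
    (by rw [hM0]; exact mem_closedSq_floorSq hδ _) (by rw [hM1]; exact mem_closedSq_floorSq hδ _)
  obtain ⟨κE', hκE'd, hκE's⟩ := exists_fluxFree_shadow hδ hIcc12 hEbc hEbΩ (P := floorSq δ qb) (P' := floorSq δ (Eb 2))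
    (by rw [hEb1]; exact mem_closedSq_floorSq hδ _) (mem_closedSq_floorSq hδ _)
  set β : (zdGraph 2).Walk nt nb := (((κt.append κE).append κM).append κE'.reverse).append κb.reverse with hβ
  have hβd : ∀ d ∈ β.darts, ∃ z ∈ sideSeg δ d.fst d.snd, z ∉ R.carrier :=
    fluxFree_append (fluxFree_append (fluxFree_append (fluxFree_append hκtd hκEd) hκMd) (fluxFree_reverse hκE'd))
      (fluxFree_reverse hκbd)
  have hβs : ∀ q ∈ β.support, (∃ x ∈ ArcT ∪ ArcB, x ∈ closedSq δ q) ∨ (∃ x ∈ Ext, x ∈ closedSq δ q) := by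
    intro q hq
    rw [hβ, Walk.mem_support_append_iff, Walk.mem_support_append_iff, Walk.mem_support_append_iff,
      Walk.mem_support_append_iff, Walk.support_reverse, Walk.support_reverse, List.mem_reverse, List.mem_reverse] at hq
    rcases hq with (((hq | hq) | hq) | hq) | hq
    · obtain ⟨x, hx, hxq⟩ := hκts q hq; exact Or.inl ⟨x, Or.inl hx, hxq⟩
    · obtain ⟨x, hx, hxq⟩ := hκEs q hq; exact Or.inr ⟨x, Or.inl (Or.inl hx), hxq⟩
    · obtain ⟨x, hx, hxq⟩ := hκMs q hq; exact Or.inr ⟨x, Or.inl (Or.inr hx), hxq⟩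
    · obtain ⟨x, hx, hxq⟩ := hκE's q hq; exact Or.inr ⟨x, Or.inr hx, hxq⟩
    · obtain ⟨x, hx, hxq⟩ := hκbs q hq; exact Or.inl ⟨x, Or.inr hx, hxq⟩
  -- ### Step 4: the closed walk
  set u₁' : (zdGraph 2).Walk (Cm + (k : ℤ) • (Pi.single 1 1 : Site 2)) pt := u₁.copy hCpfl.symm rfl with hu₁'
  set Λ₁ : (zdGraph 2).Walk nb Cm := Walk.cons hpbnb.symm w₁.reverse with hΛ₁
  set Λ₂ : (zdGraph 2).Walk (Cm + (k : ℤ) • (Pi.single 1 1 : Site 2)) nb := u₁'.append (Walk.cons hptnt β) with hΛ₂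
  set Λ : (zdGraph 2).Walk nb nb := (Λ₁.append (upRun Cm k)).append Λ₂ with hΛ
  set v : (zdGraph 2).Walk pb pt := w₁.reverse.append ((upRun Cm k).append u₁') with hv
  have hΛeq : (Walk.cons hpbnb.symm v).append (Walk.cons hptnt β) = Λ := by
    simp only [hΛ, hΛ₁, hΛ₂, hv, Walk.cons_append, Walk.append_assoc]
  -- what the squares of the pieces touch
  have hw₁touch : ∀ q ∈ w₁.support, ∃ x ∈ Aout, x ∈ closedSq δ q := by
    intro q hq
    have hq' := hw₁supp q hq
    rw [hωL, Walk.support_reverse, List.mem_reverse, Walk.mem_support_append_iff] at hq'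
    rcases hq' with h | h
    · obtain ⟨x, hx, hxq⟩ := hnear₁ q h; exact ⟨x, Or.inl (Or.inl (Or.inl hx)), hxq⟩
    · obtain ⟨x, hx, hxq⟩ := hnear₂ q h; exact ⟨x, Or.inl (Or.inl (Or.inr hx)), hxq⟩
  have hu₁touch : ∀ q ∈ u₁.support, ∃ x ∈ Aout, x ∈ closedSq δ q := by
    intro q hq
    have hq' := hu₁supp q hq
    rw [hωR, Walk.mem_support_append_iff] at hq'
    rcases hq' with h | h
    · obtain ⟨x, hx, hxq⟩ := hnear₄ q h; exact ⟨x, Or.inl (Or.inr hx), hxq⟩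
    · obtain ⟨x, hx, hxq⟩ := hnear₅ q h; exact ⟨x, Or.inr hx, hxq⟩
  have hnbtouch : ∃ x ∈ Aout, x ∈ closedSq δ nb := by
    obtain ⟨w, hw, hwA, -⟩ := hnb_near; exact ⟨w, Or.inl (Or.inl (Or.inl hwA)), hw⟩
  have hnttouch : ∃ x ∈ Aout, x ∈ closedSq δ nt := by
    obtain ⟨w, hw, hwA, -⟩ := hnt_near; exact ⟨w, Or.inr hwA, hw⟩
  have hΛ₁touch : ∀ q ∈ Λ₁.support, ∃ x ∈ Aout, x ∈ closedSq δ q := by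
    intro q hq
    rw [hΛ₁, Walk.support_cons, List.mem_cons, Walk.support_reverse, List.mem_reverse] at hq
    rcases hq with hq | hq
    · rw [hq]; exact hnbtouch
    · exact hw₁touch q hq
  have hΛ₂touch : ∀ q ∈ Λ₂.support, (∃ x ∈ Aout, x ∈ closedSq δ q) ∨ (∃ x ∈ ArcT ∪ ArcB, x ∈ closedSq δ q) ∨ (∃ x ∈ Ext, x ∈ closedSq δ q) := by
    intro q hq
    rw [hΛ₂, Walk.mem_support_append_iff, hu₁', Walk.support_copy, Walk.support_cons, List.mem_cons] at hq
    rcases hq with hq | hq | hq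
    · exact Or.inl (hu₁touch q hq)
    · rw [hq]; exact Or.inl (hu₁touch pt (Walk.end_mem_support _))
    · exact Or.inr (hβs q hq)
  have hΛtouch : ∀ q ∈ Λ.support, (∃ x ∈ Aall, x ∈ closedSq δ q) ∨ (∃ x ∈ ArcT ∪ ArcB, x ∈ closedSq δ q) ∨ (∃ x ∈ Ext, x ∈ closedSq δ q) := by
    intro q hq
    rw [hΛ, Walk.mem_support_append_iff, Walk.mem_support_append_iff] at hq
    rcases hq with (hq | hq) | hq
    · obtain ⟨x, hx, hxq⟩ := hΛ₁touch q hq; exact Or.inl ⟨x, hAoutsub hx, hxq⟩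
    · obtain ⟨x, hx, hxq⟩ := hnear₃ q hq; exact Or.inl ⟨x, hA3sub hx, hxq⟩
    · rcases hΛ₂touch q hq with ⟨x, hx, hxq⟩ | h | h
      · exact Or.inl ⟨x, hAoutsub hx, hxq⟩
      · exact Or.inr (Or.inl h)
      · exact Or.inr (Or.inr h)
  -- separation of `Ball` from everything `Λ` touches
  have hsepArc : ∀ x ∈ ArcT ∪ ArcB, ∀ y ∈ Ball, 2 * δ < dist x y := by
    rintro x (⟨-, hx⟩ | ⟨-, hx⟩) y hy
    · have := (hd₂sep y hy).2
      have h1 := dist_triangle y x qt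
      rw [dist_comm y x] at h1
      linarith [hr'd₂]
    · have := (hd₂sep y hy).1
      have h1 := dist_triangle y x qb
      rw [dist_comm y x] at h1
      linarith [hr'd₂]
  have hBout_notΛ : ∀ q ∈ Λ.support, ¬ ∃ y ∈ Bout, y ∈ closedSq δ q := by
    intro q hq hy
    rcases hΛtouch q hq with ⟨x, hxA, hxq⟩ | ⟨x, hx, hxq⟩ | ⟨x, hx, hxq⟩
    · exact not_near_both hy ⟨x, hxA, hxq⟩ (fun a ha b hb => by linarith [hsep₂ a ha b hb])
    · obtain ⟨y, hyB, hyq⟩ := hy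
      exact not_near_both ⟨x, hx, hxq⟩ ⟨y, hBoutsub hyB, hyq⟩ hsepArc
    · obtain ⟨y, hyB, hyq⟩ := hy
      exact not_near_both ⟨x, hx, hxq⟩ ⟨y, hBoutsub hyB, hyq⟩ (fun a ha b hb => by linarith [hsep₅ a ha b hb])
  have hB3_notΛ₁ : ∀ q ∈ Λ₁.support, ¬ ∃ y ∈ B3, y ∈ closedSq δ q := by
    intro q hq hy
    obtain ⟨x, hx, hxq⟩ := hΛ₁touch q hq
    obtain ⟨y, hyB, hyq⟩ := hy
    exact not_near_both ⟨x, hx, hxq⟩ ⟨y, hB3sub hyB, hyq⟩ (fun a ha b hb => by linarith [hsep₁ a ha b hb])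
  have hB3_notΛ₂ : ∀ q ∈ Λ₂.support, ¬ ∃ y ∈ B3, y ∈ closedSq δ q := by
    intro q hq hy
    obtain ⟨y, hyB, hyq⟩ := hy
    rcases hΛ₂touch q hq with ⟨x, hx, hxq⟩ | ⟨x, hx, hxq⟩ | ⟨x, hx, hxq⟩
    · exact not_near_both ⟨x, hx, hxq⟩ ⟨y, hB3sub hyB, hyq⟩ (fun a ha b hb => by linarith [hsep₁ a ha b hb])
    · exact not_near_both ⟨x, hx, hxq⟩ ⟨y, hB3sub hyB, hyq⟩ hsepArc
    · exact not_near_both ⟨x, hx, hxq⟩ ⟨y, hB3sub hyB, hyq⟩ (fun a ha b hb => by linarith [hsep₅ a ha b hb])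
  -- ### Step 5: the face walks along `Γ_H` and the crossing
  set fs : Site 2 := floorSq δ (ΓH 0) with hfs
  set fe : Site 2 := floorSq δ (ΓH 1) with hfe
  obtain ⟨π₁, -, hπ₁s⟩ := exists_dualWalk_of_path hδ hsᵢ.le (hHc.mono (hIcc1 le_rfl (hsᵢₒ.le.trans hsₒ.le)))
    (P := fs) (P' := floorSq δ (ΓH sᵢ)) (mem_closedSq_floorSq hδ _) (mem_closedSq_floorSq hδ _)
  obtain ⟨hM₂c, hM₂0, hM₂1, hM₂im⟩ := lineMap_props (ΓH sᵢ) Qhm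
  obtain ⟨π₂, -, hπ₂s⟩ := exists_dualWalk_of_path hδ zero_le_one hM₂c (P := floorSq δ (ΓH sᵢ)) (P' := ur)
    (by show AffineMap.lineMap _ _ (0 : ℝ) ∈ _; rw [hM₂0]; exact mem_closedSq_floorSq hδ _)
    (by show AffineMap.lineMap _ _ (1 : ℝ) ∈ _; rw [hM₂1, ← hurfl]; exact mem_closedSq_floorSq hδ _)
  obtain ⟨hM₄c, hM₄0, hM₄1, hM₄im⟩ := lineMap_props Qhp (ΓH sₒ)
  obtain ⟨π₄, -, hπ₄s⟩ := exists_dualWalk_of_path hδ zero_le_one hM₄c (P := floorSq δ Qhp) (P' := floorSq δ (ΓH sₒ))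
    (by show AffineMap.lineMap _ _ (0 : ℝ) ∈ _; rw [hM₄0]; exact mem_closedSq_floorSq hδ _)
    (by show AffineMap.lineMap _ _ (1 : ℝ) ∈ _; rw [hM₄1]; exact mem_closedSq_floorSq hδ _)
  obtain ⟨π₅, -, hπ₅s⟩ := exists_dualWalk_of_path hδ hsₒ.le (hHc.mono (hIcc1 (hsᵢ.le.trans hsᵢₒ.le) le_rfl))
    (P := floorSq δ (ΓH sₒ)) (P' := fe) (mem_closedSq_floorSq hδ _) (mem_closedSq_floorSq hδ _)
  set P₁ : (zdGraph 2).Walk fs ur := π₁.append π₂ with hP₁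
  set P₂ : (zdGraph 2).Walk (ur + (m : ℤ) • (Pi.single 0 1 : Site 2)) fe := (π₄.copy hurpfl.symm rfl).append π₅ with hP₂
  have hP₁touch : ∀ q ∈ P₁.support, ∃ y ∈ Bout, y ∈ closedSq δ q := by
    intro q hq
    rw [hP₁, Walk.mem_support_append_iff] at hq
    rcases hq with hq | hq
    · obtain ⟨y, hy, hyq⟩ := near_of_shadow hπ₁s hq; exact ⟨y, Or.inl (Or.inl (Or.inl hy)), hyq⟩
    · obtain ⟨y, hy, hyq⟩ := near_of_shadow hπ₂s hq; rw [hM₂im] at hy; exact ⟨y, Or.inl (Or.inl (Or.inr hy)), hyq⟩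
  have hP₂touch : ∀ q ∈ P₂.support, ∃ y ∈ Bout, y ∈ closedSq δ q := by
    intro q hq
    rw [hP₂, Walk.mem_support_append_iff, Walk.support_copy] at hq
    rcases hq with hq | hq
    · obtain ⟨y, hy, hyq⟩ := near_of_shadow hπ₄s hq; rw [hM₄im] at hy; exact ⟨y, Or.inl (Or.inr hy), hyq⟩
    · obtain ⟨y, hy, hyq⟩ := near_of_shadow hπ₅s hq; exact ⟨y, Or.inr hy, hyq⟩
  have hP₁Λ : ∀ q ∈ P₁.support, q ∉ Λ.support := fun q hq hqΛ => hBout_notΛ q hqΛ (hP₁touch q hq)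
  have hP₂Λ : ∀ q ∈ P₂.support, q ∉ Λ.support := fun q hq hqΛ => hBout_notΛ q hqΛ (hP₂touch q hq)
  -- the squares right of the run faces touch `B3`
  have hXmlo : (Xm : ℝ) * δ ≤ c₀.re - r / 2 := by
    have := Int.floor_le ((c₀.re - r / 2) / δ); rwa [le_div_iff₀ hδ] at this
  have hXmhi : c₀.re - r / 2 < ((Xm : ℝ) + 1) * δ := by
    have := Int.lt_floor_add_one ((c₀.re - r / 2) / δ); rwa [div_lt_iff₀ hδ] at this
  have hXphi : (Xp : ℝ) * δ ≤ c₀.re + r / 2 := by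
    have := Int.floor_le ((c₀.re + r / 2) / δ); rwa [le_div_iff₀ hδ] at this
  have hYslo : (Ys : ℝ) * δ ≤ ys := by
    have := Int.floor_le (ys / δ); rwa [le_div_iff₀ hδ] at this
  have hYshi : ys ≤ ((Ys : ℝ) + 1) * δ := by
    have := (Int.lt_floor_add_one (ys / δ)).le; rwa [div_le_iff₀ hδ] at this
  have hright : ∀ j < m, ur + (j : ℤ) • (Pi.single 0 1 : Site 2) + Pi.single 0 1 ∉ Λ₁.support ∧
      ur + (j : ℤ) • (Pi.single 0 1 : Site 2) + Pi.single 0 1 ∉ Λ₂.support := by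
    intro j hj
    set X : ℤ := Xm + j + 1 with hX
    have hsq : ur + (j : ℤ) • (Pi.single 0 1 : Site 2) + Pi.single 0 1 = ![X, Ys] := by
      ext i; fin_cases i <;> simp only [Pi.add_apply, Pi.smul_apply, smul_eq_mul] <;> simp [hur, hX]
    have hjm : (j : ℤ) + 1 ≤ m := by exact_mod_cast hj
    have hX1 : c₀.re - r / 2 ≤ (X : ℝ) * δ := by
      have : ((Xm : ℝ) + 1) * δ ≤ (X : ℝ) * δ := by
        apply mul_le_mul_of_nonneg_right _ hδ.le
        rw [hX]; push_cast; have : (0:ℝ) ≤ j := by positivity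
        linarith
      linarith
    have hX2 : (X : ℝ) * δ ≤ c₀.re + r / 2 := by
      have : (X : ℝ) * δ ≤ (Xp : ℝ) * δ := by
        apply mul_le_mul_of_nonneg_right _ hδ.le
        have : X ≤ Xp := by rw [hX]; omega
        exact_mod_cast this
      linarith
    have htouch : ∃ y ∈ B3, y ∈ closedSq δ (![X, Ys] : Site 2) := by
      refine ⟨⟨(X : ℝ) * δ, ys⟩, ?_, ?_⟩
      · rw [hB3, hQhm, hQhp]
        refine ⟨(c₀.re + r / 2 - X * δ) / r, (X * δ - (c₀.re - r / 2)) / r, by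
          apply div_nonneg _ hr.le; linarith, by apply div_nonneg _ hr.le; linarith, by field_simp; ring, ?_⟩
        apply Complex.ext <;> simp <;> field_simp <;> ring
      · refine ⟨?_, ?_, ?_, ?_⟩ <;> simp
        · linarith
        · nlinarith
        · linarith
        · linarith
    rw [hsq]
    exact ⟨fun h' => hB3_notΛ₁ _ h' htouch, fun h' => hB3_notΛ₂ _ h' htouch⟩
  have hcol : ur 0 + 1 ≤ Cm 0 := by simp [hur, hCm]; omega
  have hcol' : Cm 0 ≤ ur 0 + m := by simp [hur, hCm, hmz]; omega
  have hrow : Cm 1 ≤ ur 1 := by simp [hur, hCm]; omega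
  have hrow' : ur 1 + 1 ≤ Cm 1 + k := by simp [hur, hCm, hkz]; omega
  have hcross : walkWinding Λ fs - walkWinding Λ fe = 1 :=
    walkWinding_sub_eq_one_of_cross Λ₁ Λ₂ P₁ P₂ hP₁Λ hP₂Λ hright hcol hcol' hrow hrow'
  -- ### Step 6: the winding number is constant on the faces of `T_n` and of `B_n`
  have harcface : ∀ i : Fin 4, (i = 0 ∨ i = 2) → ∀ f : Site 2,
      (∃ w ∈ closedSq δ f, Metric.infDist w (R.arc i) ≤ 2 * δ) → f ∉ Λ.support := by
    intro i hi f hf hfΛ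
    obtain ⟨w, hwf, hwd⟩ := hf
    have harcne : (R.arc i).Nonempty := ⟨_, R.pt_mem_arc_self i⟩
    obtain ⟨a, ha, hwa⟩ := (R.isCompact_arc i).exists_infDist_eq_dist harcne w
    have hwa' : dist w a ≤ 2 * δ := by rw [← hwa]; exact hwd
    have ha02 : a ∈ R.arc 0 ∪ R.arc 2 := hi.elim (fun h => Or.inl (h ▸ ha)) (fun h => Or.inr (h ▸ ha))
    rcases hΛtouch f hfΛ with ⟨x, hx, hxf⟩ | ⟨x, hx, hxf⟩ | ⟨x, hx, hxf⟩
    · have h1 := hsep₃ a ha02 x hx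
      have h2 := dist_le_of_mem_closedSq hwf hxf
      linarith [dist_triangle a w x, dist_comm a w]
    · have h2 := dist_le_of_mem_closedSq hwf hxf
      rcases hx with ⟨-, hx⟩ | ⟨-, hx⟩
      · have h1 := (hd₁sep a ha02).2
        linarith [dist_triangle a w x, dist_comm a w, dist_triangle a x qt, hr'd₁]
      · have h1 := (hd₁sep a ha02).1
        linarith [dist_triangle a w x, dist_comm a w, dist_triangle a x qb, hr'd₁]
    · have h1 := hsep₆ x hx a ha02
      have h2 := dist_le_of_mem_closedSq hwf hxf
      linarith [dist_triangle x w a, dist_comm w x]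
  -- the target faces
  have hfs' : fs = floorSq δ (R.boundary σH0) := by rw [hfs, hH0eq]
  have hfe' : fe = floorSq δ (R.boundary σH1) := by rw [hfe, hH1eq]
  have hwind_arc : ∀ (i : Fin 4), (i = 0 ∨ i = 2) → ∀ {σₑ : ℝ}, σₑ ∈ Ioo (R.mark i) (R.nextMark i) →
      ∀ x ∈ arcVertices R.carrier δ (R.arc i), walkWinding Λ (x - 1) = walkWinding Λ (floorSq δ (R.boundary σₑ)) := by
    intro i hi σₑ hσₑ x hx
    obtain ⟨Px, hPx⟩ := exists_faceWalk_along_arc R hδ i hx (Ioo_subset_Icc_self hσₑ)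
    exact walkWinding_eq_of_walk_closed Λ Px fun f hf => harcface i hi f (hPx f hf)
  -- ### Step 7: the flux identity
  have hfinB : (arcVertices R.carrier δ (R.arc 2)).Finite := (domain_finite R.isBounded hδ).subset fun x hx => hx.1.1
  set ST : Finset (Site 2) := hfin.toFinset.image (fun x => x - 1) with hST
  set SB : Finset (Site 2) := hfinB.toFinset.image (fun x => x - 1) with hSB
  have hSTmem : ∀ u, u ∈ ST ↔ u + 1 ∈ arcVertices R.carrier δ (R.arc 0) := by
    intro u
    rw [hST, Finset.mem_image]
    constructor
    · rintro ⟨x, hx, rfl⟩; rw [sub_add_cancel]; exact (Set.Finite.mem_toFinset _).1 hx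
    · intro hu; exact ⟨u + 1, (Set.Finite.mem_toFinset _).2 hu, by abel⟩
  have hSBmem : ∀ u, u ∈ SB ↔ u + 1 ∈ arcVertices R.carrier δ (R.arc 2) := by
    intro u
    rw [hSB, Finset.mem_image]
    constructor
    · rintro ⟨x, hx, rfl⟩; rw [sub_add_cancel]; exact (Set.Finite.mem_toFinset _).1 hx
    · intro hu; exact ⟨u + 1, (Set.Finite.mem_toFinset _).2 hu, by abel⟩
  -- winding constants
  set kT : ℤ := walkWinding Λ (if jL = 0 then fs else fe) with hkT
  set kB : ℤ := walkWinding Λ (if jL = 0 then fe else fs) with hkB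
  have hwT : ∀ u ∈ ST, walkWinding ((Walk.cons hpbnb.symm v).append (Walk.cons hptnt β)) u = kT := by
    intro u hu
    rw [hΛeq, hkT]
    have hx := (hSTmem u).1 hu
    rw [show u = (u + 1) - 1 by abel]
    rcases hLR with ⟨hjL, hjR⟩ | ⟨hjL, hjR⟩
    · rw [if_pos hjL, hfs']; subst hjL; exact hwind_arc 0 (Or.inl rfl) hσH0 _ hx
    · rw [if_neg (by rw [hjL]; decide), hfe']; subst hjR; exact hwind_arc 0 (Or.inl rfl) hσH1 _ hx
  have hwB : ∀ u ∈ SB, walkWinding ((Walk.cons hpbnb.symm v).append (Walk.cons hptnt β)) u = kB := by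
    intro u hu
    rw [hΛeq, hkB]
    have hx := (hSBmem u).1 hu
    rw [show u = (u + 1) - 1 by abel]
    rcases hLR with ⟨hjL, hjR⟩ | ⟨hjL, hjR⟩
    · rw [if_pos hjL, hfe']; subst hjR; exact hwind_arc 2 (Or.inr rfl) hσH1 _ hx
    · rw [if_neg (by rw [hjL]; decide), hfs']; subst hjL; exact hwind_arc 2 (Or.inr rfl) hσH0 _ hx
  have hvinner : ∀ z ∈ v.support, IsInnerSq R.carrier δ z := by
    intro z hz
    rw [hv, Walk.mem_support_append_iff, Walk.mem_support_append_iff, Walk.support_reverse, List.mem_reverse, hu₁', Walk.support_copy] at hz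
    rcases hz with hz | hz | hz
    · exact hreach_inner (hw₁F z hz)
    · exact hcol_inner z hz
    · exact hreach_inner (hu₁F z hz)
  have hTsub : arcVertices R.carrier δ (R.arc 0) ⊆ boundary R.carrier δ := fun x hx => hx.1
  have hBsub : arcVertices R.carrier δ (R.arc 2) ⊆ boundary R.carrier δ := fun x hx => hx.1
  have hident := exitVal_sub_exitVal_eq R h0 hδ hTsub hBsub hTBn hharm hp₀inner hpbnb.symm hptnt v hvinner hpbF β hβd
    ST SB hSTmem hSBmem hwT hwB
  -- ### Step 8: conclusion
  have hkdiff : ((kT - kB : ℤ) : ℝ) = if jL = 0 then (1 : ℝ) else -1 := by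
    rcases hLR with ⟨hjL, -⟩ | ⟨hjL, -⟩
    · simp only [hkT, hkB, if_pos hjL]; rw [hcross]; simp
    · have hne : jL ≠ 0 := by rw [hjL]; decide
      simp only [hkT, hkB, if_neg hne]
      rw [show walkWinding Λ fe - walkWinding Λ fs = -(walkWinding Λ fs - walkWinding Λ fe) by ring, hcross]; simp
  have hsum : ∑ u ∈ ST, divAt (curH R.carrier δ h) (curV R.carrier δ h) u =
      ∑ x ∈ hfin.toFinset, divAt (curH R.carrier δ h) (curV R.carrier δ h) (x - 1) := by
    rw [hST, Finset.sum_image fun x _ y _ h => sub_left_inj.1 h]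
  refine ⟨hp₀inner, pb, nb, pt, nt, hpbnb, hptnt, hpbF, hptF, hnbF, hntF, ?_, ?_, ?_⟩
  · obtain ⟨w, hw, -, hwd⟩ := hnb_near
    exact ⟨w, hw, hwd.trans_le ((half_le_self (by positivity)).trans (min_le_right _ _))⟩
  · obtain ⟨w, hw, -, hwd⟩ := hnt_near
    exact ⟨w, hw, hwd.trans_le ((half_le_self (by positivity)).trans (min_le_right _ _))⟩
  · rw [hident, hkdiff, hsum]

end MainLattice
end SquareTiling

end Literature.Probability.LatticeModels
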